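import Mathlib
import Summits.KontsevichZagierPeriods.KontsevichZagierPeriods.Theses.HermiteRigidity
import Summits.KontsevichZagierPeriods.KontsevichZagierPeriods.Theorems.RealEllipticSectorKernel.Negative.Core
import Summits.KontsevichZagierPeriods.KontsevichZagierPeriods.Theorems.HermiteRigidityRealEllipticSectorKernelStubExactForm
import Summits.KontsevichZagierPeriods.KontsevichZagierPeriods.Theorems.EllipticMomentKernel.Negative.Targets
import Summits.KontsevichZagierPeriods.KontsevichZagierPeriods.Theorems.ReducedPeriodRing.Negative.Certificates
import Literature.NumberTheory.Transcendental.KZRelationsLE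
import Literature.NumberTheory.Transcendental.KZLogCalculusProofs
import Literature.NumberTheory.Transcendental.KZSubcalculusInvariants
import Literature.NumberTheory.Transcendental.KZSemialgebraicComplex
import Literature.NumberTheory.Transcendental.SemialgebraicMapsProofs

/-!
# Drefute gen 3 — line `oval-hermite-engine` of crux `RealEllipticSectorKernel`
# (stmt-KontsevichZagierPeriods-10632): the stub set is CONSISTENT AND TRUE — all four registered
# stubs are theorems exactly as typed, and the skeleton's own glue then closes the crux sorry-free.

Refuter seat `refuter-drefute-stmt-KontsevichZagierPeriods-10632-g3-0` (mode drefute, gen 3), attacking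
the lead's REGISTERED stub set of `Cruxes/RealEllipticSectorKernel/Lines/oval-hermite-engine.lean`
(sha256 `be982d63baee…`, stubs `stub_roots`, `stub_exactForm`, `stub_twoTorsion`, `stub_reduction`).
This file is a CERTIFICATE for the stub attack, not a landing (the crux is the lead's to land; the two
open stubs belong to their holders). Everything lives in the refuter namespace
`Summit.KontsevichZagierPeriods.HermiteRigidity.RealEllipticSectorKernel.DrefuteG3[.MoveCopy]`, so no
FQN of the tree is (re)declared; it is self-contained over BUILT tree modules (the farm served
`…Theorems.HermiteRigidityTwoTorsionTransferMove` and `…StubRoots` unbuilt at the time of writing,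
hence Parts A and D are verbatim re-homed copies of those two landed files).

* Part A — the real algebra / semialgebraic geometry of the 2-torsion translation `Φ`, VERBATIM from
  `Theorems/HermiteRigidityTwoTorsionTransferMove.lean` (item 3413, p78052).
* Part B — **`stub_twoTorsion` PROVED as typed**: ONE `KZ.changeOfVariablesRel` instance between the
  two GIVEN presentations (source `r''` on `(e₁,∞)`, target `r` on `(e₃,e₂)`), every rule-2 side
  condition on the unbounded domain discharged; Vieta read off `hf` at `x = 0, ±1`; the source
  domain's semialgebraicity is the field `r''.isSemialgebraic_domain`; `ha₁ ha₂ ha₃` unused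
  (underscored — a verbatim warning-free landing must do the same).
* Part C — **`stub_reduction` PROVED as typed** (the lead-held bookkeeping stub): Hermite's
  decomposition (re-homed from `SketchIdeator3`), denominator clearing to `N·X^m = a + bX + D_g Q`,
  the combination `s = N·r − a·b₀ − b·b₁` as two difference representations of `constMul` copies,
  `hExact Q s`, two rule-1b moves and integer scaling (`of_constMul_int_sub_zsmul_mem_relations`,
  new). No hypothesis on `u`, `v` or the sign of `g` is used.
* Part D — `stub_roots`, VERBATIM from the landed `Theorems/HermiteRigidityRealEllipticSectorKernelStubRoots.lean`.
* Part E — the skeleton's glue and composition `RealEllipticSectorKernel_of`, VERBATIM, and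
  `realEllipticSectorKernel_lineClosed : RealEllipticSectorKernel` from Parts B–D plus the LANDED
  `…RealEllipticSectorKernel.stub_exactForm` (p76437).
* Part F — bonus: `twoTorsionTransfer_candidate : TwoTorsionTransfer` (route support item 3413) from
  `stub_roots` + `stub_twoTorsion`.

Verdict of the stub attack: 0 stub-false, 0 stub-misstated, 4 survived — each stub is a theorem as
typed, so no counterexample, vacuity or mis-typing exists; the line closes
(`DrefuteG3.realEllipticSectorKernel_lineClosed`, axioms `propext`, `Classical.choice`, `Quot.sound`).
-/

noncomputable section

/-! # Part A — two-torsion: the real algebra / semialgebraic geometry of `Φ`, VERBATIM from the landed helper file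
`Theorems/HermiteRigidityTwoTorsionTransferMove.lean` (item 3413, p78052; re-homed to the namespace
`…DrefuteG3.MoveCopy` only because the farm serves that module unbuilt at the time of writing —
no FQN of the tree is redeclared). -/

namespace Summit.KontsevichZagierPeriods.HermiteRigidity.RealEllipticSectorKernel.DrefuteG3.MoveCopy

open Set MvPolynomial
open Literature.NumberTheory.Transcendental Literature.ModelTheory.ExponentialFields

/-! ### The `2`-torsion translation `Φ(x) = e₂ + (e₂ − e₁)(e₂ − e₃)/(x − e₂)` -/

/-- **Invariance of `dx/y` under a `2`-torsion translation** (Whittaker–Watson §20.33 differentiated):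
with `Φ(x) = e₂ + a/(x − e₂)`, `a = (e₂ − e₁)(e₁ + 2e₂) = (e₂ − e₁)(e₂ − e₃)`, one has
`f(Φ(x)) = Φ′(x)² f(x)`, `Φ′(x) = −a/(x − e₂)²`, for `f(x) = 4(x − e₁)(x − e₂)(x + e₁ + e₂)`.
[cite: WhittakerWatson1927, §20.33] -/
theorem cubic_phi (e₁ e₂ x : ℝ) (hx : x ≠ e₂) :
    4 * (e₂ + (e₂ - e₁) * (e₁ + 2 * e₂) / (x - e₂) - e₁) *
        (e₂ + (e₂ - e₁) * (e₁ + 2 * e₂) / (x - e₂) - e₂) *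
        (e₂ + (e₂ - e₁) * (e₁ + 2 * e₂) / (x - e₂) + e₁ + e₂) =
      (-((e₂ - e₁) * (e₁ + 2 * e₂)) / (x - e₂) ^ 2) ^ 2 *
        (4 * (x - e₁) * (x - e₂) * (x + e₁ + e₂)) := by
  have h : x - e₂ ≠ 0 := sub_ne_zero.mpr hx
  field_simp
  ring

/-- `Φ` is an involution off `x = e₂` (`(e₂, 0)` is `2`-torsion). [folklore] -/
theorem phi_phi {a e₂ y : ℝ} (ha : a ≠ 0) (hy : y ≠ e₂) :
    e₂ + a / (e₂ + a / (y - e₂) - e₂) = y := by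
  have h1 : y - e₂ ≠ 0 := sub_ne_zero.mpr hy
  have h2 : e₂ + a / (y - e₂) - e₂ = a / (y - e₂) := by ring
  rw [h2]
  field_simp
  ring

/-- The derivative of `Φ(x) = e₂ + a/(x − e₂)` is `−a/(x − e₂)²`. [folklore] -/
theorem hasDerivAt_phi (a e₂ x : ℝ) (hx : x ≠ e₂) :
    HasDerivAt (fun y => e₂ + a / (y - e₂)) (-a / (x - e₂) ^ 2) x := by
  have h0 : x - e₂ ≠ 0 := sub_ne_zero.mpr hx
  have h1 : HasDerivAt (fun y => y - e₂) 1 x := (hasDerivAt_id x).sub_const e₂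
  have h2 : HasDerivAt (fun y => (y - e₂)⁻¹) (-(1 : ℝ) / (x - e₂) ^ 2) x := h1.inv h0
  have h3 : HasDerivAt (fun y => e₂ + a * (y - e₂)⁻¹) (a * (-(1 : ℝ) / (x - e₂) ^ 2)) x :=
    (h2.const_mul a).const_add e₂
  have h4 : (fun y : ℝ => e₂ + a / (y - e₂)) = fun y => e₂ + a * (y - e₂)⁻¹ := by
    funext y
    rw [div_eq_mul_inv]
  rw [h4]
  refine h3.congr_deriv ?_
  ring

/-- On `(e₁, ∞)` the translate `Φ(x)` lies in the oval `(e₃, e₂)`. [folklore] -/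
theorem phi_mem_Ioo {e₁ e₂ : ℝ} (h21 : e₂ < e₁) (h32 : -e₁ - e₂ < e₂) {x : ℝ} (hx : e₁ < x) :
    e₂ + (e₂ - e₁) * (e₁ + 2 * e₂) / (x - e₂) ∈ Ioo (-e₁ - e₂) e₂ := by
  have hx2 : 0 < x - e₂ := by linarith
  have ha : (e₂ - e₁) * (e₁ + 2 * e₂) < 0 := mul_neg_of_neg_of_pos (by linarith) (by linarith)
  constructor
  · have : e₂ + (e₂ - e₁) * (e₁ + 2 * e₂) / (x - e₂) - (-e₁ - e₂) =
        (e₁ + 2 * e₂) * (x - e₁) / (x - e₂) := by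
      field_simp
      ring
    have hpos : 0 < (e₁ + 2 * e₂) * (x - e₁) / (x - e₂) :=
      div_pos (mul_pos (by linarith) (by linarith)) hx2
    linarith
  · have : (e₂ - e₁) * (e₁ + 2 * e₂) / (x - e₂) < 0 := div_neg_of_neg_of_pos ha hx2
    linarith

/-- Every point of the oval `(e₃, e₂)` is `Φ(x)` for a (unique) `x > e₁`, namely `x = Φ(y)`.
[folklore] -/
theorem lt_phi_of_mem_Ioo {e₁ e₂ : ℝ} (h21 : e₂ < e₁) {y : ℝ} (hy : y ∈ Ioo (-e₁ - e₂) e₂) : e₁ < e₂ + (e₂ - e₁) * (e₁ + 2 * e₂) / (y - e₂) := by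
  have hy2 : y - e₂ < 0 := by linarith [hy.2]
  have : e₂ + (e₂ - e₁) * (e₁ + 2 * e₂) / (y - e₂) - e₁ =
      (e₂ - e₁) * (y + e₁ + e₂) / (y - e₂) := by
    have : y - e₂ ≠ 0 := hy2.ne
    field_simp
    ring
  have hpos : 0 < (e₂ - e₁) * (y + e₁ + e₂) / (y - e₂) :=
    div_pos_of_neg_of_neg (mul_neg_of_neg_of_pos (by linarith) (by linarith [hy.1])) hy2
  linarith

/-- The image of `(e₁, ∞)` under `Φ` is exactly the oval `(e₃, e₂)`. [folklore] -/
theorem image_phi_eq {e₁ e₂ : ℝ} (h21 : e₂ < e₁) (h32 : -e₁ - e₂ < e₂) :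
    (fun p : Fin 1 → ℝ => fun _ : Fin 1 => e₂ + (e₂ - e₁) * (e₁ + 2 * e₂) / (p 0 - e₂)) ''
        {p : Fin 1 → ℝ | e₁ < p 0} = {p : Fin 1 → ℝ | -e₁ - e₂ < p 0 ∧ p 0 < e₂} := by
  have ha : (e₂ - e₁) * (e₁ + 2 * e₂) ≠ 0 :=
    (mul_neg_of_neg_of_pos (by linarith) (by linarith)).ne
  ext q
  simp only [mem_image, mem_setOf_eq]
  constructor
  · rintro ⟨p, hp, rfl⟩
    exact phi_mem_Ioo h21 h32 hp
  · rintro hq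
    refine ⟨fun _ => e₂ + (e₂ - e₁) * (e₁ + 2 * e₂) / (q 0 - e₂), lt_phi_of_mem_Ioo h21 hq, ?_⟩
    funext i
    rw [Fin.fin_one_eq_zero i]
    exact phi_phi ha hq.2.ne

/-! ### `Φ` is `ℚ`-semialgebraic (one Tarski–Seidenberg projection) -/

/-- **`Φ` is `ℚ`-semialgebraic on `(e₁, ∞)`.** Although `e₂` is irrational in general, the graph of
`Φ(x) = e₂ + (e₂ − e₁)(e₂ − e₃)/(x − e₂)` over `σ'' = (e₁, ∞)` is the projection forgetting `t` of
the `ℚ`-semialgebraic set `{(x, y, t) | x ∈ σ'', f(t) = 0, 12t² − q₂ < 0, 4(y − t)(x − t) = 12t² − q₂}`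
(`e₂` is the unique root of `f` at which `f′ = 12t² − q₂` is negative, and
`f′(e₂) = 4(e₂ − e₁)(e₂ − e₃)`), hence `ℚ`-semialgebraic by the Tarski–Seidenberg theorem
(`tarski_seidenberg_real_holds`). [cite: BochnakCosteRoy1998, Thm. 2.2.1] -/
theorem phi_semialgebraic {q₂ q₃ : ℚ} {e₁ e₂ : ℝ} (h21 : e₂ < e₁) (h32 : -e₁ - e₂ < e₂)
    (hA : (q₂ : ℝ) = 4 * (e₁ ^ 2 + e₁ * e₂ + e₂ ^ 2)) (hB : (q₃ : ℝ) = -4 * e₁ * e₂ * (e₁ + e₂))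
    (hS : IsSemialgebraic ℚ {p : Fin 1 → ℝ | e₁ < p 0}) :
    IsSemialgebraicFunOn ℚ {p : Fin 1 → ℝ | e₁ < p 0}
      (fun p => e₂ + (e₂ - e₁) * (e₁ + 2 * e₂) / (p 0 - e₂)) := by
  have hf : ∀ t : ℝ, 4 * t ^ 3 - (q₂ : ℝ) * t - (q₃ : ℝ) =
      4 * (t - e₁) * (t - e₂) * (t + e₁ + e₂) := fun t => by
    rw [hA, hB]; ring
  have h12 : 12 * e₂ ^ 2 - (q₂ : ℝ) = 4 * ((e₂ - e₁) * (e₁ + 2 * e₂)) := by rw [hA]; ring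
  -- `e₂` is the only root with `f' < 0`
  have hroot : ∀ t : ℝ, 4 * t ^ 3 - (q₂ : ℝ) * t - (q₃ : ℝ) = 0 →
      12 * t ^ 2 - (q₂ : ℝ) < 0 → t = e₂ := by
    intro t ht ht'
    rw [hf] at ht
    rcases mul_eq_zero.mp ht with h | h
    · rcases mul_eq_zero.mp h with h | h
      · have hte : t = e₁ := by linarith
        rw [hte, hA] at ht'
        nlinarith
      · exact sub_eq_zero.mp h
    · have hte : t = -e₁ - e₂ := by linarith
      rw [hte, hA] at ht'
      nlinarith
  -- the semialgebraic set upstairs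
  have hW : IsSemialgebraic ℚ
      ((((fun w : Fin 3 → ℝ => w ∘ fun _ : Fin 1 => (0 : Fin 3)) ⁻¹' {p : Fin 1 → ℝ | e₁ < p 0}) ∩
        {w : Fin 3 → ℝ | 4 * w 2 ^ 3 - (q₂ : ℝ) * w 2 - (q₃ : ℝ) = 0}) ∩
        {w : Fin 3 → ℝ | 12 * w 2 ^ 2 - (q₂ : ℝ) < 0} ∩
        {w : Fin 3 → ℝ | 4 * (w 1 - w 2) * (w 0 - w 2) - (12 * w 2 ^ 2 - (q₂ : ℝ)) = 0}) := by
    refine (((hS.preimage_comp fun _ : Fin 1 => (0 : Fin 3)).inter ?_).inter ?_).inter ?_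
    · convert isSemialgebraic_setOf_eval_eq_zero (k := ℚ) (R := ℝ)
        (4 * X 2 ^ 3 - C q₂ * X 2 - C q₃ : MvPolynomial (Fin 3) ℚ) using 2 with w
      simp
    · convert isSemialgebraic_setOf_eval_pos (k := ℚ) (R := ℝ)
        (C q₂ - 12 * X 2 ^ 2 : MvPolynomial (Fin 3) ℚ) using 2 with w
      simp only [map_sub, map_mul, map_pow, aeval_X, aeval_C, eq_ratCast, sub_neg, sub_pos]
      norm_num
    · convert isSemialgebraic_setOf_eval_eq_zero (k := ℚ) (R := ℝ)
        (4 * (X 1 - X 2) * (X 0 - X 2) - (12 * X 2 ^ 2 - C q₂) : MvPolynomial (Fin 3) ℚ)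
        using 2 with w
      simp
  rw [isSemialgebraicFunOn_iff]
  convert tarski_seidenberg_real_holds hW using 1
  ext z
  have e0 : Fin.init z 0 = z 0 := rfl
  have e1 : z (Fin.last 1) = z 1 := rfl
  simp only [mem_setOf_eq, mem_image, mem_inter_iff, mem_preimage, e0, e1, Function.comp_apply]
  constructor
  · rintro ⟨hz0, hz1⟩
    refine ⟨Fin.snoc z e₂, ⟨⟨⟨?_, ?_⟩, ?_⟩, ?_⟩, ?_⟩
    · simpa [Fin.snoc] using hz0
    · simp [Fin.snoc, hf]
    · have ha : (e₂ - e₁) * (e₁ + 2 * e₂) < 0 :=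
        mul_neg_of_neg_of_pos (by linarith) (by linarith)
      have s2 : (Fin.snoc z e₂ : Fin 3 → ℝ) 2 = e₂ := by simp [Fin.snoc]
      rw [s2, h12]
      linarith
    · have hx2 : z 0 - e₂ ≠ 0 := by
        have : e₂ < z 0 := h21.trans hz0
        exact (sub_pos.mpr this).ne'
      have s0 : (Fin.snoc z e₂ : Fin 3 → ℝ) 0 = z 0 := by simp [Fin.snoc]
      have s1 : (Fin.snoc z e₂ : Fin 3 → ℝ) 1 = z 1 := by simp [Fin.snoc]
      have s2 : (Fin.snoc z e₂ : Fin 3 → ℝ) 2 = e₂ := by simp [Fin.snoc]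
      rw [s0, s1, s2, hz1, h12]
      field_simp
      ring
    · funext i
      simp
  · rintro ⟨w, ⟨⟨⟨hw0, hwr⟩, hwd⟩, hwg⟩, rfl⟩
    have hw0' : e₁ < w 0 := hw0
    have ht : w 2 = e₂ := hroot _ hwr hwd
    refine ⟨hw0', ?_⟩
    have hx2 : w 0 - e₂ ≠ 0 := by
      have : e₂ < w 0 := h21.trans hw0'
      exact (sub_pos.mpr this).ne'
    rw [ht, h12] at hwg
    have e2 : (w ∘ Fin.castSucc) 1 = w 1 := rfl
    have e3 : (w ∘ Fin.castSucc) 0 = w 0 := rfl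
    have key : w 1 - e₂ = (e₂ - e₁) * (e₁ + 2 * e₂) / (w 0 - e₂) := by
      rw [eq_div_iff hx2]
      linear_combination (1 / 4 : ℝ) * hwg
    rw [e2, e3]
    linarith [key]

end Summit.KontsevichZagierPeriods.HermiteRigidity.RealEllipticSectorKernel.DrefuteG3.MoveCopy


/-! # Parts B–E — refuter namespace `…RealEllipticSectorKernel.DrefuteG3` -/

namespace Summit.KontsevichZagierPeriods.HermiteRigidity.RealEllipticSectorKernel.DrefuteG3

open MeasureTheory Set Polynomial
open Literature.NumberTheory.Transcendental Literature.ModelTheory.ExponentialFields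
open Summit.KontsevichZagierPeriods.RealEllipticSectorKernel.Negative
open Summit.KontsevichZagierPeriods.HermiteRigidity.RealEllipticSectorKernel.DrefuteG3.MoveCopy
open Summit.KontsevichZagierPeriods.KontsevichZagierPeriods.Theses.HermiteRigidity (RealEllipticSectorKernel)

/-! # Part B — `stub_twoTorsion` -/

/-! ## The move `Φ` on `ℝ¹` and its derivative -/

/-- The `2`-torsion translation `Φ(x) = e₂ + (e₂ − e₁)(e₁ + 2e₂)/(x − e₂)` on `ℝ¹`
(`(e₂ − e₁)(e₁ + 2e₂) = (e₂ − e₁)(e₂ − e₃)` when `e₃ = −e₁ − e₂`). [cite: WhittakerWatson1927, §20.33] -/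
def phiMap (e₁ e₂ : ℝ) (p : Fin 1 → ℝ) : Fin 1 → ℝ :=
  fun _ => e₂ + (e₂ - e₁) * (e₁ + 2 * e₂) / (p 0 - e₂)

/-- Its Fréchet derivative `Φ′(x) • id`, `Φ′(x) = −(e₂ − e₁)(e₁ + 2e₂)/(x − e₂)²`. [folklore] -/
def phiDeriv (e₁ e₂ : ℝ) (p : Fin 1 → ℝ) : (Fin 1 → ℝ) →L[ℝ] (Fin 1 → ℝ) :=
  (-((e₂ - e₁) * (e₁ + 2 * e₂)) / (p 0 - e₂) ^ 2) • ContinuousLinearMap.id ℝ (Fin 1 → ℝ)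

theorem phiMap_apply (e₁ e₂ : ℝ) (p : Fin 1 → ℝ) (i : Fin 1) :
    phiMap e₁ e₂ p i = e₂ + (e₂ - e₁) * (e₁ + 2 * e₂) / (p 0 - e₂) := rfl

/-- `Φ` is Fréchet differentiable off `x = e₂`, with derivative `phiDeriv`. [folklore] -/
theorem hasFDerivAt_phiMap (e₁ e₂ : ℝ) {p : Fin 1 → ℝ} (hp : p 0 ≠ e₂) :
    HasFDerivAt (phiMap e₁ e₂) (phiDeriv e₁ e₂ p) p := by
  have h1 : HasFDerivAt (fun q : Fin 1 → ℝ => q 0) (ContinuousLinearMap.proj 0) p :=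
    hasFDerivAt_apply (𝕜 := ℝ) 0 p
  have h2 : HasFDerivAt
      ((fun y : ℝ => e₂ + (e₂ - e₁) * (e₁ + 2 * e₂) / (y - e₂)) ∘ fun q : Fin 1 → ℝ => q 0)
      ((-((e₂ - e₁) * (e₁ + 2 * e₂)) / (p 0 - e₂) ^ 2) •
        ContinuousLinearMap.proj (R := ℝ) (φ := fun _ : Fin 1 => ℝ) 0) p :=
    HasDerivAt.comp_hasFDerivAt p (hasDerivAt_phi ((e₂ - e₁) * (e₁ + 2 * e₂)) e₂ (p 0) hp) h1
  rw [hasFDerivAt_pi']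
  intro i
  have h3 : (ContinuousLinearMap.proj i).comp (phiDeriv e₁ e₂ p) =
      (-((e₂ - e₁) * (e₁ + 2 * e₂)) / (p 0 - e₂) ^ 2) •
        ContinuousLinearMap.proj (R := ℝ) (φ := fun _ : Fin 1 => ℝ) 0 := by
    ext v
    simp [phiDeriv, Fin.fin_one_eq_zero i]
  rw [h3]
  exact h2

/-- `det (c • id) = c` on `ℝ¹`. [folklore] -/
theorem det_phiDeriv (e₁ e₂ : ℝ) (p : Fin 1 → ℝ) :
    (phiDeriv e₁ e₂ p).det = -((e₂ - e₁) * (e₁ + 2 * e₂)) / (p 0 - e₂) ^ 2 := by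
  have h1 : ((phiDeriv e₁ e₂ p : (Fin 1 → ℝ) →L[ℝ] (Fin 1 → ℝ)) : (Fin 1 → ℝ) →ₗ[ℝ] (Fin 1 → ℝ)) =
      (-((e₂ - e₁) * (e₁ + 2 * e₂)) / (p 0 - e₂) ^ 2) • LinearMap.id := by
    ext x i; simp [phiDeriv]
  unfold ContinuousLinearMap.det
  rw [h1, LinearMap.det_smul, LinearMap.det_id, Module.finrank_fin_fun]
  simp

/-- `Φ` is injective on `(e₁, ∞)` (indeed a Möbius involution). [folklore] -/
theorem phiMap_injOn {e₁ e₂ : ℝ} (h21 : e₂ < e₁) (h32 : -e₁ - e₂ < e₂) :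
    InjOn (phiMap e₁ e₂) {p : Fin 1 → ℝ | e₁ < p 0} := by
  intro p hp q hq h
  have hp' : e₁ < p 0 := hp
  have hq' : e₁ < q 0 := hq
  have ha : (e₂ - e₁) * (e₁ + 2 * e₂) ≠ 0 :=
    (mul_neg_of_neg_of_pos (by linarith) (by linarith)).ne
  have hp2 : p 0 - e₂ ≠ 0 := by apply ne_of_gt; linarith
  have hq2 : q 0 - e₂ ≠ 0 := by apply ne_of_gt; linarith
  have h0 := congr_fun h 0
  simp only [phiMap_apply, add_right_inj] at h0
  rw [div_eq_div_iff hp2 hq2] at h0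
  have h1 : q 0 - e₂ = p 0 - e₂ := mul_left_cancel₀ ha h0
  funext i
  rw [Fin.fin_one_eq_zero i]
  linarith

/-! ## Vieta from the factorisation hypothesis -/

/-- From `4x³ − q₂x − q₃ = 4(x − e₁)(x − e₂)(x − e₃)` for all `x`: `e₃ = −e₁ − e₂`,
`q₂ = 4(e₁² + e₁e₂ + e₂²)`, `q₃ = −4e₁e₂(e₁ + e₂)` (evaluate at `x = 0, 1, −1`). [folklore] -/
theorem vieta_of_factorisation {q₂ q₃ : ℚ} {e₁ e₂ e₃ : ℝ}
    (hf : ∀ x, cubic q₂ q₃ x = 4 * (x - e₁) * (x - e₂) * (x - e₃)) :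
    e₃ = -e₁ - e₂ ∧ (q₂ : ℝ) = 4 * (e₁ ^ 2 + e₁ * e₂ + e₂ ^ 2) ∧
      (q₃ : ℝ) = -4 * e₁ * e₂ * (e₁ + e₂) := by
  have h0 := hf 0
  have h1 := hf 1
  have h2 := hf (-1)
  simp only [cubic] at h0 h1 h2
  have hsum : e₃ = -e₁ - e₂ := by linear_combination ((1 : ℝ) / 8) * (h1 + h2 - 2 * h0)
  refine ⟨hsum, ?_, ?_⟩
  · subst hsum; linear_combination (-(1 : ℝ) / 2) * (h1 - h2)
  · subst hsum; linear_combination -h0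

/-! ## The stub -/

/-- **`stub_twoTorsion`, verbatim signature (skeleton `be982d63baee…`), sorry-free.** Translation by
the `2`-torsion point `(e₂, 0)`, `Φ(x) = e₂ + (e₂−e₁)(e₂−e₃)/(x−e₂)`, is ONE rule-2 move carrying
`[(e₁,∞), 1/√f]` onto `[(e₃,e₂), 1/√f]`: `Φ` is a `ℚ`-semialgebraic map on `(e₁,∞)`
(`phi_semialgebraic`, Tarski–Seidenberg; the domain is semialgebraic as a field of `r''`),
differentiable within the domain (`hasFDerivAt_phiMap`), injective (`phiMap_injOn`), with image
exactly `(e₃,e₂)` (`image_phi_eq`), and the Jacobian weight is exact: `f(Φx) = Φ′(x)² f(x)`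
(`cubic_phi`), so `1/√f(x) = (1/√f(Φx))·|Φ′(x)|`. [cite: WhittakerWatson1927, §20.33] -/
theorem stub_twoTorsion (q₂ q₃ : ℚ) (e₁ e₂ e₃ : ℝ) (h₃₂ : e₃ < e₂) (h₂₁ : e₂ < e₁)
    (_ha₁ : IsAlgebraic ℚ e₁) (_ha₂ : IsAlgebraic ℚ e₂) (_ha₃ : IsAlgebraic ℚ e₃)
    (hf : ∀ x, cubic q₂ q₃ x = 4 * (x - e₁) * (x - e₂) * (x - e₃))
    (r'' r : KZ.IntegralRep 1)
    (hr'' : r''.domain = {p | e₁ < p 0})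
    (hri'' : EqOn r''.integrand (fun p => 1 / Real.sqrt (cubic q₂ q₃ (p 0))) r''.domain)
    (hr : r.domain = {p | e₃ < p 0 ∧ p 0 < e₂})
    (hri : EqOn r.integrand (fun p => 1 / Real.sqrt (cubic q₂ q₃ (p 0))) r.domain) :
    KZ.of r'' - KZ.of r ∈ KZ.relations := by
  obtain ⟨he₃, hA, hB⟩ := vieta_of_factorisation hf
  have h32 : -e₁ - e₂ < e₂ := he₃ ▸ h₃₂
  have hS : IsSemialgebraic ℚ {p : Fin 1 → ℝ | e₁ < p 0} := hr'' ▸ r''.isSemialgebraic_domain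
  have hf' : ∀ y, cubic q₂ q₃ y = 4 * (y - e₁) * (y - e₂) * (y + e₁ + e₂) := fun y => by
    rw [hf, he₃]; ring
  have hapos : 0 < -((e₂ - e₁) * (e₁ + 2 * e₂)) := by
    have : (e₂ - e₁) * (e₁ + 2 * e₂) < 0 := mul_neg_of_neg_of_pos (by linarith) (by linarith)
    linarith
  refine KZ.changeOfVariablesRel_subset_relations
    ⟨1, r'', r, phiMap e₁ e₂, phiDeriv e₁ e₂, ?_, ?_, ?_, ?_, ?_, rfl⟩
  · -- `Φ` is a `ℚ`-semialgebraic map on the source domain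
    rw [hr'']
    exact IsSemialgebraicMapOn.of_forall hS fun _ => phi_semialgebraic h₂₁ h32 hA hB hS
  · -- derivative within the domain
    intro p hp
    rw [hr''] at hp
    have hp : e₁ < p 0 := hp
    exact (hasFDerivAt_phiMap e₁ e₂ (ne_of_gt (h₂₁.trans hp))).hasFDerivWithinAt
  · -- injective
    rw [hr'']
    exact phiMap_injOn h₂₁ h32
  · -- image exactly the oval
    rw [hr, hr'', he₃]
    exact (image_phi_eq h₂₁ h32).symm
  · -- exact Jacobian weight
    intro p hp
    rw [hr''] at hp
    have hp : e₁ < p 0 := hp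
    have hΦmem : phiMap e₁ e₂ p ∈ r.domain := by
      rw [hr, he₃]
      exact phi_mem_Ioo h₂₁ h32 hp
    have hw1 : r''.integrand p = 1 / Real.sqrt (cubic q₂ q₃ (p 0)) := hri'' (by rw [hr'']; exact hp)
    have hw2 : r.integrand (phiMap e₁ e₂ p) =
        1 / Real.sqrt (cubic q₂ q₃ (e₂ + (e₂ - e₁) * (e₁ + 2 * e₂) / (p 0 - e₂))) := hri hΦmem
    rw [hw1, hw2, det_phiDeriv]
    have hpe : p 0 ≠ e₂ := ne_of_gt (h₂₁.trans hp)
    have hx2 : 0 < (p 0 - e₂) ^ 2 := by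
      have : 0 < p 0 - e₂ := by linarith
      positivity
    set d : ℝ := -((e₂ - e₁) * (e₁ + 2 * e₂)) / (p 0 - e₂) ^ 2 with hd
    have hdpos : 0 < d := div_pos hapos hx2
    have hfx : 0 < cubic q₂ q₃ (p 0) := by
      rw [hf']
      have h1 : 0 < p 0 - e₁ := by linarith
      have h2 : 0 < p 0 - e₂ := by linarith
      have h3 : 0 < p 0 + e₁ + e₂ := by linarith
      positivity
    have hkey : cubic q₂ q₃ (e₂ + (e₂ - e₁) * (e₁ + 2 * e₂) / (p 0 - e₂)) =
        d ^ 2 * cubic q₂ q₃ (p 0) := by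
      rw [hf', hf', hd]
      exact cubic_phi e₁ e₂ (p 0) hpe
    rw [hkey, Real.sqrt_mul' _ hfx.le, Real.sqrt_sq hdpos.le, abs_of_pos hdpos]
    have hs : 0 < Real.sqrt (cubic q₂ q₃ (p 0)) := Real.sqrt_pos.mpr hfx
    field_simp


/-! # Part C — `stub_reduction` -/

/-! ## Hermite's decomposition (pure algebra over `ℚ[X]`) -/

/-- Coefficients of the twisted derivative of a monomial, `D_g (X^k) = k X^{k-1} g + X^k g′/2`.
[folklore] -/
theorem coeff_twistedDeriv_X_pow (g : ℚ[X]) (k j : ℕ) :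
    (derivative (X ^ k) * g + X ^ k * derivative g * C (1 / 2 : ℚ)).coeff j
      = (k : ℚ) * (if k - 1 ≤ j then g.coeff (j - (k - 1)) else 0)
        + (if k ≤ j then g.coeff (j - k + 1) * ((j - k : ℕ) + 1 : ℚ) else 0) * (1 / 2 : ℚ) := by
  rw [derivative_X_pow, mul_assoc, coeff_add, coeff_C_mul, coeff_X_pow_mul', coeff_mul_C,
    coeff_X_pow_mul', coeff_derivative]

/-- **Hermite's decomposition** `ℚ[X] = ℚ[X]_{<deg g − 1} + D_g ℚ[X]`, `D_g Q = Q′g + Qg′/2`, for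
every `g` of positive degree (degree induction on the leading term: `D_g (X^k)` has degree
`k + deg g − 1` and leading coefficient `lc(g)·(k + deg g/2) ≠ 0`).
[cite: BostanLairezSalvy2013, §1 (Hermite reduction)] -/
theorem hermite_decomposition (g : ℚ[X]) (hd : 0 < g.natDegree) (P : ℚ[X]) :
    ∃ (R Q : ℚ[X]), R.degree < ((g.natDegree - 1 : ℕ) : WithBot ℕ) ∧
      P = R + (derivative Q * g + Q * derivative g * C (1 / 2 : ℚ)) := by
  set d := g.natDegree with hd_def
  have hg0 : g ≠ 0 := by
    rintro rfl
    simp [hd_def] at hd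
  have hlc : g.leadingCoeff ≠ 0 := leadingCoeff_ne_zero.mpr hg0
  have hlcd : g.coeff d = g.leadingCoeff := by rw [hd_def, coeff_natDegree]
  have hcast : ((d - 1 : ℕ) : ℚ) + 1 = d := by
    rw [← Nat.cast_add_one, Nat.sub_add_cancel hd]
  -- the twisted derivation and its linearity
  set D : ℚ[X] → ℚ[X] := fun Q => derivative Q * g + Q * derivative g * C (1 / 2 : ℚ) with hD
  -- top coefficient and vanishing above, for `D (X^k)`
  have hcoeff_top : ∀ k : ℕ, (D (X ^ k)).coeff (k + d - 1) =
      g.leadingCoeff * ((k : ℚ) + (d : ℚ) / 2) := by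
    intro k
    simp only [hD]
    rw [coeff_twistedDeriv_X_pow, if_pos (by omega), if_pos (by omega)]
    rcases Nat.eq_zero_or_pos k with rfl | hk
    · have e1 : 0 + d - 1 - 0 + 1 = d := by omega
      have e2 : 0 + d - 1 - 0 = d - 1 := by omega
      rw [e1, e2, hcast, hlcd]
      push_cast
      ring
    · have e1 : k + d - 1 - (k - 1) = d := by omega
      have e2 : k + d - 1 - k = d - 1 := by omega
      rw [e1, e2, Nat.sub_add_cancel hd, hcast, hlcd]
      ring
  have hcoeff_gt : ∀ k j : ℕ, k + d - 1 < j → (D (X ^ k)).coeff j = 0 := by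
    intro k j hj
    simp only [hD]
    rw [coeff_twistedDeriv_X_pow, if_pos (by omega), if_pos (by omega)]
    have h2 : g.coeff (j - k + 1) = 0 := coeff_eq_zero_of_natDegree_lt (by omega)
    rcases Nat.eq_zero_or_pos k with rfl | hk
    · rw [h2]; simp
    · have h1 : g.coeff (j - (k - 1)) = 0 := coeff_eq_zero_of_natDegree_lt (by omega)
      rw [h1, h2]; simp
  -- induction on the degree of `P`
  induction P using WellFounded.induction Polynomial.degree_lt_wf with
  | _ P ih =>
    by_cases hP : P.degree < ((d - 1 : ℕ) : WithBot ℕ)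
    · exact ⟨P, 0, hP, by simp⟩
    · have hP0 : P ≠ 0 := by
        rintro rfl
        exact hP (by rw [degree_zero]; exact WithBot.bot_lt_coe _)
      set N := P.natDegree with hN
      have hdegP : P.degree = N := degree_eq_natDegree hP0
      have hNd : d - 1 ≤ N := by
        rw [not_lt, hdegP] at hP
        exact_mod_cast hP
      set k := N - (d - 1) with hk
      have hkN : k + d - 1 = N := by omega
      set c : ℚ := g.leadingCoeff * ((k : ℚ) + (d : ℚ) / 2) with hc
      have hkd : (0 : ℚ) < (k : ℚ) + (d : ℚ) / 2 := by positivity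
      have hc0 : c ≠ 0 := mul_ne_zero hlc hkd.ne'
      set a : ℚ := P.leadingCoeff / c with ha
      set P₁ := P - C a * D (X ^ k) with hP₁
      have hdeg₁ : P₁.degree < P.degree := by
        rw [hdegP, degree_lt_iff_coeff_zero]
        intro j hj
        rw [hP₁, coeff_sub, coeff_C_mul]
        rcases hj.lt_or_eq with hlt | heq
        · rw [hcoeff_gt k j (by omega), mul_zero, sub_zero]
          exact coeff_eq_zero_of_natDegree_lt hlt
        · rw [← heq, ← hkN, hcoeff_top k, hkN, ← hc, ha, div_mul_cancel₀ _ hc0, hN,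
            coeff_natDegree, sub_self]
      obtain ⟨R, Q₁, hR, hPQ⟩ := ih P₁ hdeg₁
      refine ⟨R, Q₁ + C a * X ^ k, hR, ?_⟩
      have key : P = P₁ + C a * D (X ^ k) := by rw [hP₁]; ring
      rw [key, hPQ]
      simp only [hD, derivative_add, derivative_mul, derivative_C, zero_mul, zero_add]
      ring

/-- A polynomial of degree `< 2` is `C (coeff 0) + C (coeff 1) · X`. [folklore] -/
theorem eq_C_add_C_mul_X_of_degree_lt_two {R : ℚ[X]} (hR : R.degree < (2 : ℕ)) :
    R = C (R.coeff 0) + C (R.coeff 1) * X := by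
  rw [degree_lt_iff_coeff_zero] at hR
  ext j
  rcases j with _ | _ | j
  · simp
  · simp
  · rw [hR (j + 2) (by omega)]
    simp

/-- **Hermite's integer normal form for a cubic**: for `deg g = 3` and every `m` there are
`N ≥ 1`, `a b ∈ ℤ` and `Q ∈ ℚ[X]` with `N·X^m = a + b·X + (Q′g + Qg′/2)` in `ℚ[X]`.
[cite: BostanLairezSalvy2013, §1 (Hermite reduction)] -/
theorem hermite_integer_normal_form (g : ℚ[X]) (hg : g.natDegree = 3) (m : ℕ) :
    ∃ (N : ℕ) (a b : ℤ) (Q : ℚ[X]), 0 < N ∧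
      C (N : ℚ) * X ^ m = C (a : ℚ) + C (b : ℚ) * X +
        (derivative Q * g + Q * derivative g * C (1 / 2 : ℚ)) := by
  obtain ⟨R, Q, hR, hdec⟩ := hermite_decomposition g (by omega) (X ^ m)
  rw [hg] at hR
  have hR' : R = C (R.coeff 0) + C (R.coeff 1) * X :=
    eq_C_add_C_mul_X_of_degree_lt_two (by simpa using hR)
  set α : ℚ := R.coeff 0 with hα
  set β : ℚ := R.coeff 1 with hβ
  refine ⟨α.den * β.den, α.num * β.den, β.num * α.den, C ((α.den * β.den : ℕ) : ℚ) * Q,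
    Nat.mul_pos α.den_pos β.den_pos, ?_⟩
  have hαN : ((α.den * β.den : ℕ) : ℚ) * α = ((α.num * β.den : ℤ) : ℚ) := by
    push_cast
    have := Rat.mul_den_eq_num α
    linear_combination (β.den : ℚ) * this
  have hβN : ((α.den * β.den : ℕ) : ℚ) * β = ((β.num * α.den : ℤ) : ℚ) := by
    push_cast
    have := Rat.mul_den_eq_num β
    linear_combination (α.den : ℚ) * this
  have key : C ((α.den * β.den : ℕ) : ℚ) * X ^ m =
      C ((α.den * β.den : ℕ) : ℚ) * R +
        C ((α.den * β.den : ℕ) : ℚ) * (derivative Q * g + Q * derivative g * C (1 / 2 : ℚ)) := by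
    conv_lhs => rw [hdec]
    ring
  rw [key, hR', ← hαN, ← hβN]
  simp only [derivative_mul, derivative_C, zero_mul, zero_add, map_mul]
  ring

/-! ## Bookkeeping in `KZ.FormalRep` -/

section Bookkeeping

variable {n : ℕ}

/-- The difference representation `[σ, f₁ − f₂]` of two representations with the same domain
(semialgebraic by `IsSemialgebraicFunOn.sub_holds`, integrable by `Integrable.sub`). [folklore] -/
def subRep (r₁ r₂ : KZ.IntegralRep n) (h : r₂.domain = r₁.domain) : KZ.IntegralRep n where
  domain := r₁.domain
  integrand := r₁.integrand - r₂.integrand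
  isSemialgebraic_domain := r₁.isSemialgebraic_domain
  isSemialgebraicFunOn_integrand :=
    IsSemialgebraicFunOn.sub_holds r₁.isSemialgebraicFunOn_integrand
      (by rw [← h]; exact r₂.isSemialgebraicFunOn_integrand)
  integrableOn := r₁.integrableOn.sub (by rw [← h]; exact r₂.integrableOn)

@[simp] theorem subRep_domain (r₁ r₂ : KZ.IntegralRep n) (h : r₂.domain = r₁.domain) :
    (subRep r₁ r₂ h).domain = r₁.domain := rfl

@[simp] theorem subRep_integrand (r₁ r₂ : KZ.IntegralRep n) (h : r₂.domain = r₁.domain) :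
    (subRep r₁ r₂ h).integrand = r₁.integrand - r₂.integrand := rfl

/-- `[σ, f₁] − [σ, f₁ − f₂] − [σ, f₂]` is ONE integrand-additivity move (rule 1b). [folklore] -/
theorem of_sub_of_subRep_sub_of_mem_relations (r₁ r₂ : KZ.IntegralRep n)
    (h : r₂.domain = r₁.domain) :
    KZ.of r₁ - KZ.of (subRep r₁ r₂ h) - KZ.of r₂ ∈ KZ.relations :=
  KZ.integrandAddRel_subset_relations
    ⟨n, r₁, subRep r₁ r₂ h, r₂, rfl, h, fun x _ => by simp, rfl⟩

/-- **Integer scaling is a derived rule**: `[σ, a·f] − a•[σ, f] ∈ relations` for every `a ∈ ℤ`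
(the tree's `ℕ`-version `of_constMul_nat_sub_nsmul_mem_relations` plus `[σ,−kf] + [σ,kf] ∈
relations`). [folklore] -/
theorem of_constMul_int_sub_zsmul_mem_relations (r : KZ.IntegralRep n) (a : ℤ) :
    KZ.of (r.constMul (a : ℝ) (isAlgebraic_int a)) - a • KZ.of r ∈ KZ.relations := by
  cases a with
  | ofNat k =>
    have h1 := r.of_constMul_nat_sub_nsmul_mem_relations k
    have h2 : KZ.of (r.constMul ((Int.ofNat k : ℤ) : ℝ) (isAlgebraic_int _)) -
        KZ.of (r.constMul (k : ℝ) (isAlgebraic_nat k)) ∈ KZ.relations :=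
      KZ.of_sub_of_mem_relations_of_eqOn rfl fun x _ => by simp
    have e : KZ.of (r.constMul ((Int.ofNat k : ℤ) : ℝ) (isAlgebraic_int _)) - (Int.ofNat k) • KZ.of r
        = (KZ.of (r.constMul ((Int.ofNat k : ℤ) : ℝ) (isAlgebraic_int _)) -
            KZ.of (r.constMul (k : ℝ) (isAlgebraic_nat k))) +
          (KZ.of (r.constMul (k : ℝ) (isAlgebraic_nat k)) - k • KZ.of r) := by
      rw [Int.ofNat_eq_natCast, natCast_zsmul]
      abel
    rw [e]
    exact add_mem h2 h1
  | negSucc k =>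
    have h1 := r.of_constMul_nat_sub_nsmul_mem_relations (k + 1)
    have h2 : KZ.of (r.constMul ((k + 1 : ℕ) : ℝ) (isAlgebraic_nat (k + 1))) +
        KZ.of (r.constMul ((Int.negSucc k : ℤ) : ℝ) (isAlgebraic_int _)) ∈ KZ.relations :=
      KZ.of_add_of_mem_relations_of_eqOn_neg rfl fun x _ => by
        simp only [KZ.IntegralRep.integrand_constMul, Int.cast_negSucc, Pi.neg_apply]
        ring
    have e : KZ.of (r.constMul ((Int.negSucc k : ℤ) : ℝ) (isAlgebraic_int _)) -
          (Int.negSucc k) • KZ.of r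
        = (KZ.of (r.constMul ((k + 1 : ℕ) : ℝ) (isAlgebraic_nat (k + 1))) +
            KZ.of (r.constMul ((Int.negSucc k : ℤ) : ℝ) (isAlgebraic_int _))) -
          (KZ.of (r.constMul ((k + 1 : ℕ) : ℝ) (isAlgebraic_nat (k + 1))) - (k + 1) • KZ.of r) := by
      rw [negSucc_zsmul]
      abel
    rw [e]
    exact sub_mem h2 h1

end Bookkeeping

/-! ## The stub `stub_reduction` -/

/-- **`stub_reduction`, verbatim signature (skeleton `be982d63baee…`), sorry-free.** Hermite
reduction of one moment generator to the INTEGER normal form: given the exact-form property of `g`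
on `(u,v)` and representations `b₀ = [(u,v), 1/√g]`, `b₁ = [(u,v), x/√g]`, every
`r = [(u,v), xᵐ/√g]` satisfies `N•[r] ≡ a•[b₀] + b•[b₁]` modulo relations for some `N ≥ 1`,
`a b ∈ ℤ`. Proof: `N·xᵐ = a + b·x + D_g(Q)` (`hermite_integer_normal_form`); the representation
`s = [(u,v), N·r − a·b₀ − b·b₁]` (two `subRep`s of `constMul` copies) has integrand
`D_g(Q)(x)/√g(x)` ON the domain (pointwise; where `g ≤ 0` both sides are the same junk), so
`hExact Q s` makes it a relation, and `N•[r] − a•[b₀] − b•[b₁] ≡ [s]` by two rule-1b moves and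
integer scaling. No hypothesis on `u`, `v` or the sign of `g` is used. [folklore] -/
theorem stub_reduction (g : ℚ[X]) (hg : g.natDegree = 3) (u v : ℝ)
    (hExact : ∀ (Q : ℚ[X]) (s : KZ.IntegralRep 1), s.domain = {p | u < p 0 ∧ p 0 < v} →
      EqOn s.integrand (fun p => (aeval (p 0) (derivative Q) * aeval (p 0) g
        + aeval (p 0) Q * aeval (p 0) (derivative g) / 2) / Real.sqrt (aeval (p 0) g)) s.domain →
      KZ.of s ∈ KZ.relations)
    (b₀ b₁ r : KZ.IntegralRep 1) (m : ℕ)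
    (hb₀ : b₀.domain = {p | u < p 0 ∧ p 0 < v})
    (hb₀i : EqOn b₀.integrand (fun p => 1 / Real.sqrt (aeval (p 0) g)) b₀.domain)
    (hb₁ : b₁.domain = {p | u < p 0 ∧ p 0 < v})
    (hb₁i : EqOn b₁.integrand (fun p => p 0 / Real.sqrt (aeval (p 0) g)) b₁.domain)
    (hr : r.domain = {p | u < p 0 ∧ p 0 < v})
    (hri : EqOn r.integrand (fun p => p 0 ^ m / Real.sqrt (aeval (p 0) g)) r.domain) :
    ∃ (N : ℕ) (a b : ℤ), 0 < N ∧ N • KZ.of r - (a • KZ.of b₀ + b • KZ.of b₁) ∈ KZ.relations := by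
  obtain ⟨N, a, b, Q, hN, hpoly⟩ := hermite_integer_normal_form g hg m
  -- the real form of Hermite's identity
  have hreal : ∀ x : ℝ, (N : ℝ) * x ^ m - a - b * x =
      aeval x (derivative Q) * aeval x g + aeval x Q * aeval x (derivative g) / 2 := by
    intro x
    have h := congrArg (aeval x) hpoly
    simp only [map_mul, map_add, map_pow, aeval_X, aeval_C, eq_ratCast, Rat.cast_natCast,
      Rat.cast_intCast] at h
    push_cast at h
    linear_combination h
  -- the three scaled copies and the combination `s = N·r − a·b₀ − b·b₁`
  set rN := r.constMul (N : ℝ) (isAlgebraic_nat N) with hrN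
  set bA := b₀.constMul (a : ℝ) (isAlgebraic_int a) with hbA
  set bB := b₁.constMul (b : ℝ) (isAlgebraic_int b) with hbB
  have hdA : bA.domain = rN.domain := by
    simp only [hbA, hrN, KZ.IntegralRep.domain_constMul, hb₀, hr]
  set t := subRep rN bA hdA with ht
  have hdB : bB.domain = t.domain := by
    simp only [hbB, ht, subRep_domain, hrN, KZ.IntegralRep.domain_constMul, hb₁, hr]
  set s := subRep t bB hdB with hs
  have hs_dom : s.domain = {p | u < p 0 ∧ p 0 < v} := by
    simp only [hs, ht, subRep_domain, hrN, KZ.IntegralRep.domain_constMul, hr]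
  have hs_int : EqOn s.integrand (fun p => (aeval (p 0) (derivative Q) * aeval (p 0) g
      + aeval (p 0) Q * aeval (p 0) (derivative g) / 2) / Real.sqrt (aeval (p 0) g)) s.domain := by
    intro p hp
    rw [hs_dom] at hp
    have hpr : p ∈ r.domain := by rw [hr]; exact hp
    have hp0 : p ∈ b₀.domain := by rw [hb₀]; exact hp
    have hp1 : p ∈ b₁.domain := by rw [hb₁]; exact hp
    simp only [hs, ht, subRep_integrand, hrN, hbA, hbB, KZ.IntegralRep.integrand_constMul,
      Pi.sub_apply]
    rw [hri hpr, hb₀i hp0, hb₁i hp1, ← hreal (p 0)]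
    ring
  have hs_rel : KZ.of s ∈ KZ.relations := hExact Q s hs_dom hs_int
  -- bookkeeping: `N•[r] − a•[b₀] − b•[b₁] ≡ [rN] − [bA] − [bB] ≡ [s] ≡ 0`
  have h1 := of_sub_of_subRep_sub_of_mem_relations rN bA hdA
  have h2 := of_sub_of_subRep_sub_of_mem_relations t bB hdB
  have h3 := r.of_constMul_nat_sub_nsmul_mem_relations N
  have h4 := of_constMul_int_sub_zsmul_mem_relations b₀ a
  have h5 := of_constMul_int_sub_zsmul_mem_relations b₁ b
  refine ⟨N, a, b, hN, ?_⟩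
  have e : N • KZ.of r - (a • KZ.of b₀ + b • KZ.of b₁) =
      (KZ.of rN - KZ.of t - KZ.of bA) + (KZ.of t - KZ.of s - KZ.of bB) + KZ.of s
        - (KZ.of rN - N • KZ.of r) + (KZ.of bA - a • KZ.of b₀) + (KZ.of bB - b • KZ.of b₁) := by
    abel
  rw [e]
  exact add_mem (add_mem (sub_mem (add_mem (add_mem h1 h2) hs_rel) h3) h4) h5


/-! # Part D — `stub_roots` (verbatim from the landed StubRoots file) -/

section Roots

variable {q₂ q₃ : ℚ}

/-! ### Bridges to the sibling crux `EllipticMomentKernel` (same bodies, different constants) -/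

/-- The sibling crux's `cubic` is this crux's `cubic` (same body). [folklore] -/
theorem roots_emk_cubic_eq : EllipticMomentKernelNegative.cubic = cubic := rfl

/-- The sibling crux's `disc` is this crux's `discr` (same body). [folklore] -/
theorem roots_emk_disc_eq : EllipticMomentKernelNegative.disc = discr := rfl

/-- The sibling crux's `oval` is this crux's `σ₁` (same body). [folklore] -/
theorem roots_emk_oval_eq : EllipticMomentKernelNegative.oval = σ₁ := rfl

/-- Three located real roots `e₃ < e₂ < e₁` with `f = 4(x − e₃)(x − e₂)(x − e₁)` when `Δ > 0`
(transported from `EllipticMomentKernelNegative.exists_roots`). [folklore] -/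
theorem roots_exists (h : 0 < discr q₂ q₃) :
    ∃ e₃ e₂ e₁ : ℝ, e₃ < e₂ ∧ e₂ < e₁ ∧
      ∀ x, cubic q₂ q₃ x = 4 * (x - e₃) * (x - e₂) * (x - e₁) := by
  rw [← roots_emk_disc_eq] at h
  obtain ⟨e₃, e₂, e₁, h3, h2a, h2b, h1, hf⟩ := EllipticMomentKernelNegative.exists_roots h
  rw [roots_emk_cubic_eq] at hf
  exact ⟨e₃, e₂, e₁, h3.trans h2a, h2b.trans h1, hf⟩

/-- Sign pattern of the factored cubic: positive on `(e₃, e₂)`, negative on `(e₂, e₁)`, positive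
on `(e₁, ∞)`, and `{f > 0} = (e₃, e₂) ∪ (e₁, ∞)` (transported from the sibling crux). [folklore] -/
theorem roots_cubic_signs {e₃ e₂ e₁ : ℝ} (h32 : e₃ < e₂) (h21 : e₂ < e₁)
    (hf : ∀ x, cubic q₂ q₃ x = 4 * (x - e₃) * (x - e₂) * (x - e₁)) :
    (∀ x ∈ Ioo e₃ e₂, 0 < cubic q₂ q₃ x) ∧ (∀ x ∈ Ioo e₂ e₁, cubic q₂ q₃ x < 0) ∧
      (∀ x, e₁ < x → 0 < cubic q₂ q₃ x) ∧ (∀ x, 0 < cubic q₂ q₃ x → x ∈ Ioo e₃ e₂ ∨ e₁ < x) := by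
  rw [← roots_emk_cubic_eq] at hf ⊢
  obtain ⟨hpos, hneg⟩ := EllipticMomentKernelNegative.cubic_sign_of_roots h32 h21 hf
  exact ⟨hpos, hneg, fun x hx => EllipticMomentKernelNegative.cubic_pos_of_gt h32 h21 hf hx,
    fun x hx => EllipticMomentKernelNegative.mem_Ioo_or_gt_of_cubic_pos h32 h21 hf hx⟩

/-! ### The three typed root-free sets as intervals -/

/-- **`σ = (e₃, e₂)`** for the located roots (the sibling crux's `oval_eq_of_roots`). [folklore] -/
theorem roots_σ₁_eq {e₃ e₂ e₁ : ℝ} (h32 : e₃ < e₂) (h21 : e₂ < e₁)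
    (hf : ∀ x, cubic q₂ q₃ x = 4 * (x - e₃) * (x - e₂) * (x - e₁)) :
    σ₁ q₂ q₃ = {p | e₃ < p 0 ∧ p 0 < e₂} := by
  rw [← roots_emk_cubic_eq] at hf
  rw [← roots_emk_oval_eq, EllipticMomentKernelNegative.oval_eq_of_roots h32 h21 hf]
  rfl

/-- **`σ' = (e₂, e₁)`**: `f(x) < 0` puts `x` in `(−∞, e₃) ∪ (e₂, e₁)`, and a point `t < x` with
`f(t) > 0` lies in `(e₃, e₂)` (were `t > e₁`, also `f(x) > 0`), which excludes `(−∞, e₃]`;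
conversely from `x ∈ (e₂, e₁)` take `t = (e₃ + e₂)/2`. [folklore] -/
theorem roots_σ₂_eq {e₃ e₂ e₁ : ℝ} (h32 : e₃ < e₂) (h21 : e₂ < e₁)
    (hf : ∀ x, cubic q₂ q₃ x = 4 * (x - e₃) * (x - e₂) * (x - e₁)) :
    σ₂ q₂ q₃ = {p | e₂ < p 0 ∧ p 0 < e₁} := by
  obtain ⟨hpos, hneg, hgt, hcases⟩ := roots_cubic_signs h32 h21 hf
  ext p
  simp only [σ₂, mem_setOf_eq]
  constructor
  · rintro ⟨hp, t, htp, hft⟩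
    -- the witness `t` lies in `(e₃, e₂)`: otherwise `e₁ < t < p 0` and `f (p 0) > 0`
    have h3 : e₃ < p 0 := by
      rcases hcases t hft with ht | ht
      · exact ht.1.trans htp
      · exact absurd hp (not_lt.2 (hgt _ (ht.trans htp)).le)
    rw [hf] at hp
    have ha : 0 < p 0 - e₃ := sub_pos.2 h3
    constructor
    · by_contra h2
      push Not at h2
      -- `p 0 ∈ (e₃, e₂]`: the product `(p 0 − e₂)(p 0 − e₁)` of two nonpositive factors is `≥ 0`
      have hbc : 0 ≤ (p 0 - e₂) * (p 0 - e₁) :=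
        mul_nonneg_of_nonpos_of_nonpos (by linarith) (by linarith)
      have : 0 ≤ 4 * (p 0 - e₃) * (p 0 - e₂) * (p 0 - e₁) := by
        rw [show 4 * (p 0 - e₃) * (p 0 - e₂) * (p 0 - e₁)
            = 4 * (p 0 - e₃) * ((p 0 - e₂) * (p 0 - e₁)) by ring]
        positivity
      linarith
    · by_contra h1
      push Not at h1
      -- `e₁ ≤ p 0`: all three factors are `≥ 0`
      have hb : 0 ≤ p 0 - e₂ := by linarith
      have hc : 0 ≤ p 0 - e₁ := sub_nonneg.2 h1
      have : 0 ≤ 4 * (p 0 - e₃) * (p 0 - e₂) * (p 0 - e₁) := by positivity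
      linarith
  · intro hp
    exact ⟨hneg _ hp, (e₃ + e₂) / 2, by linarith [hp.1], hpos _ ⟨by linarith, by linarith⟩⟩

/-- **`σ'' = (e₁, ∞)`**: `f(x) > 0` puts `x` in `(e₃, e₂) ∪ (e₁, ∞)`, and on `(e₃, e₂)` the point
`t = (e₂ + e₁)/2 > x` has `f(t) < 0`; conversely right of `e₁` the cubic stays positive.
[folklore] -/
theorem roots_σ₃_eq {e₃ e₂ e₁ : ℝ} (h32 : e₃ < e₂) (h21 : e₂ < e₁)
    (hf : ∀ x, cubic q₂ q₃ x = 4 * (x - e₃) * (x - e₂) * (x - e₁)) :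
    σ₃ q₂ q₃ = {p | e₁ < p 0} := by
  obtain ⟨-, hneg, hgt, hcases⟩ := roots_cubic_signs h32 h21 hf
  ext p
  simp only [σ₃, mem_setOf_eq]
  constructor
  · rintro ⟨hp, hall⟩
    rcases hcases _ hp with h | h
    · exact absurd (hall ((e₂ + e₁) / 2) (by linarith [h.2]))
        (not_lt.2 (hneg _ ⟨by linarith, by linarith⟩).le)
    · exact h
  · intro hp
    exact ⟨hgt _ hp, fun t ht => hgt _ (hp.trans ht)⟩

/-! ### Algebraicity of the roots -/

/-- The three roots of the factored cubic are algebraic over `ℚ` (roots of the non-zero rational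
cubic; the sibling crux's `isAlgebraic_of_cubic_eq_zero` and `cubic_roots_eq_zero`). [folklore] -/
theorem roots_isAlgebraic {e₃ e₂ e₁ : ℝ}
    (hf : ∀ x, cubic q₂ q₃ x = 4 * (x - e₃) * (x - e₂) * (x - e₁)) :
    IsAlgebraic ℚ e₁ ∧ IsAlgebraic ℚ e₂ ∧ IsAlgebraic ℚ e₃ := by
  rw [← roots_emk_cubic_eq] at hf
  obtain ⟨h₃, h₂, h₁⟩ := EllipticMomentKernelNegative.cubic_roots_eq_zero hf
  exact ⟨EllipticMomentKernelNegative.isAlgebraic_of_cubic_eq_zero h₁,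
    EllipticMomentKernelNegative.isAlgebraic_of_cubic_eq_zero h₂,
    EllipticMomentKernelNegative.isAlgebraic_of_cubic_eq_zero h₃⟩

/-! ### The stub `stub_roots` -/

/-- **Stub `stub_roots`** (registered stub of crux stmt-KontsevichZagierPeriods-10632, line
`oval-hermite-engine`). Three located real algebraic roots `e₃ < e₂ < e₁` of the rational cubic
with `Δ > 0`, the factorisation `f = 4(x−e₁)(x−e₂)(x−e₃)`, and the three typed ovals as intervals:
`σ = (e₃,e₂)`, `σ' = (e₂,e₁)`, `σ'' = (e₁,∞)`. [folklore] -/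
theorem stub_roots (q₂ q₃ : ℚ) (hΔ : 0 < discr q₂ q₃) :
    ∃ e₁ e₂ e₃ : ℝ, e₃ < e₂ ∧ e₂ < e₁ ∧ IsAlgebraic ℚ e₁ ∧ IsAlgebraic ℚ e₂ ∧ IsAlgebraic ℚ e₃ ∧
      (∀ x, cubic q₂ q₃ x = 4 * (x - e₁) * (x - e₂) * (x - e₃)) ∧
      σ₁ q₂ q₃ = {p | e₃ < p 0 ∧ p 0 < e₂} ∧
      σ₂ q₂ q₃ = {p | e₂ < p 0 ∧ p 0 < e₁} ∧
      σ₃ q₂ q₃ = {p | e₁ < p 0} := by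
  obtain ⟨e₃, e₂, e₁, h32, h21, hf⟩ := roots_exists hΔ
  obtain ⟨ha₁, ha₂, ha₃⟩ := roots_isAlgebraic hf
  exact ⟨e₁, e₂, e₃, h32, h21, ha₁, ha₂, ha₃, fun x => by rw [hf]; ring,
    roots_σ₁_eq h32 h21 hf, roots_σ₂_eq h32 h21 hf, roots_σ₃_eq h32 h21 hf⟩


end Roots

/-! # Part E — the skeleton's glue and composition (verbatim), and the closing -/

/-! ## Glue: the polynomial, semialgebraicity, basis representations -/

/-- The Weierstrass cubic is the evaluation of `4X³ − q₂X − q₃ ∈ ℚ[X]`. [folklore] -/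
theorem aeval_cubicPoly (q₂ q₃ : ℚ) (x : ℝ) :
    aeval x (4 * X ^ 3 - C q₂ * X - C q₃ : ℚ[X]) = cubic q₂ q₃ x := by
  simp only [map_sub, map_mul, map_pow, aeval_X, aeval_C, eq_ratCast, map_ofNat, cubic]

/-- … and of its negative. [folklore] -/
theorem aeval_neg_cubicPoly (q₂ q₃ : ℚ) (x : ℝ) :
    aeval x (-(4 * X ^ 3 - C q₂ * X - C q₃) : ℚ[X]) = - cubic q₂ q₃ x := by
  rw [map_neg, aeval_cubicPoly]

/-- `4X³ − q₂X − q₃` has degree `3`. [folklore] -/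
theorem natDegree_cubicPoly (q₂ q₃ : ℚ) :
    (4 * X ^ 3 - C q₂ * X - C q₃ : ℚ[X]).natDegree = 3 := by
  have h4 : (C 4 : ℚ[X]) = 4 := map_ofNat C 4
  have h : (4 * X ^ 3 - C q₂ * X - C q₃ : ℚ[X]) = C 4 * X ^ 3 + C 0 * X ^ 2 + C (-q₂) * X + C (-q₃) := by
    rw [h4]
    simp only [map_zero, zero_mul, add_zero, map_neg, neg_mul]
    ring
  rw [h]
  exact natDegree_cubic (by norm_num)

/-- `−(4X³ − q₂X − q₃)` has degree `3`. [folklore] -/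
theorem natDegree_neg_cubicPoly (q₂ q₃ : ℚ) :
    (-(4 * X ^ 3 - C q₂ * X - C q₃) : ℚ[X]).natDegree = 3 := by
  rw [natDegree_neg, natDegree_cubicPoly]

/-- The cubic as an `MvPolynomial` evaluation in the `i`-th coordinate. [folklore] -/
theorem mvaeval_cubic {n : ℕ} (q₂ q₃ : ℚ) (i : Fin n) (w : Fin n → ℝ) :
    MvPolynomial.aeval w (4 * MvPolynomial.X i ^ 3 - MvPolynomial.C q₂ * MvPolynomial.X i -
      MvPolynomial.C q₃ : MvPolynomial (Fin n) ℚ) = cubic q₂ q₃ (w i) := by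
  simp [cubic]

/-- `{w | 0 < f (w i)}` is `ℚ`-semialgebraic. [folklore] -/
theorem isSemialgebraic_cubic_pos {n : ℕ} (q₂ q₃ : ℚ) (i : Fin n) :
    IsSemialgebraic ℚ {w : Fin n → ℝ | 0 < cubic q₂ q₃ (w i)} := by
  convert isSemialgebraic_setOf_eval_pos (k := ℚ) (R := ℝ)
    (4 * MvPolynomial.X i ^ 3 - MvPolynomial.C q₂ * MvPolynomial.X i -
      MvPolynomial.C q₃ : MvPolynomial (Fin n) ℚ) using 1
  ext w
  rw [mem_setOf_eq, mem_setOf_eq, mvaeval_cubic]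

/-- `{w | f (w i) < 0}` is `ℚ`-semialgebraic. [folklore] -/
theorem isSemialgebraic_cubic_neg {n : ℕ} (q₂ q₃ : ℚ) (i : Fin n) :
    IsSemialgebraic ℚ {w : Fin n → ℝ | cubic q₂ q₃ (w i) < 0} := by
  convert isSemialgebraic_setOf_eval_pos (k := ℚ) (R := ℝ)
    (-(4 * MvPolynomial.X i ^ 3 - MvPolynomial.C q₂ * MvPolynomial.X i -
      MvPolynomial.C q₃) : MvPolynomial (Fin n) ℚ) using 1
  ext w
  rw [mem_setOf_eq, mem_setOf_eq, map_neg, mvaeval_cubic, neg_pos]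

/-- `{w | w i < w j}` is `ℚ`-semialgebraic. [folklore] -/
theorem isSemialgebraic_lt {n : ℕ} (i j : Fin n) :
    IsSemialgebraic ℚ {w : Fin n → ℝ | w i < w j} := by
  convert isSemialgebraic_setOf_eval_pos (k := ℚ) (R := ℝ)
    (MvPolynomial.X j - MvPolynomial.X i : MvPolynomial (Fin n) ℚ) using 2 with w
  simp [sub_pos]

/-- **`σ` as typed is `ℚ`-semialgebraic** (projection of `{(x,t) | f x > 0, x < t, f t < 0}`).
[folklore] -/
theorem isSemialgebraic_σ₁ (q₂ q₃ : ℚ) : IsSemialgebraic ℚ (σ₁ q₂ q₃) := by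
  have hT : IsSemialgebraic ℚ
      {w : Fin 2 → ℝ | 0 < cubic q₂ q₃ (w 0) ∧ w 0 < w 1 ∧ cubic q₂ q₃ (w 1) < 0} := by
    convert ((isSemialgebraic_cubic_pos q₂ q₃ (0 : Fin 2)).inter (isSemialgebraic_lt (0 : Fin 2) 1)).inter
      (isSemialgebraic_cubic_neg q₂ q₃ (1 : Fin 2)) using 1
    ext w
    simp [and_assoc]
  convert hT.image_comp (fun _ : Fin 1 => (0 : Fin 2)) using 1
  ext p
  simp only [σ₁, mem_setOf_eq, mem_image, Function.comp_def]
  constructor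
  · rintro ⟨hp, t, hpt, ht⟩
    refine ⟨![p 0, t], ⟨by simpa using hp, by simpa using hpt, by simpa using ht⟩, ?_⟩
    funext i
    rw [Fin.fin_one_eq_zero i]
    simp
  · rintro ⟨w, ⟨h0, h01, h1⟩, rfl⟩
    exact ⟨h0, w 1, h01, h1⟩

/-- **`σ'` as typed is `ℚ`-semialgebraic.** [folklore] -/
theorem isSemialgebraic_σ₂ (q₂ q₃ : ℚ) : IsSemialgebraic ℚ (σ₂ q₂ q₃) := by
  have hT : IsSemialgebraic ℚ
      {w : Fin 2 → ℝ | cubic q₂ q₃ (w 0) < 0 ∧ w 1 < w 0 ∧ 0 < cubic q₂ q₃ (w 1)} := by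
    convert ((isSemialgebraic_cubic_neg q₂ q₃ (0 : Fin 2)).inter (isSemialgebraic_lt (1 : Fin 2) 0)).inter
      (isSemialgebraic_cubic_pos q₂ q₃ (1 : Fin 2)) using 1
    ext w
    simp [and_assoc]
  convert hT.image_comp (fun _ : Fin 1 => (0 : Fin 2)) using 1
  ext p
  simp only [σ₂, mem_setOf_eq, mem_image, Function.comp_def]
  constructor
  · rintro ⟨hp, t, hpt, ht⟩
    refine ⟨![p 0, t], ⟨by simpa using hp, by simpa using hpt, by simpa using ht⟩, ?_⟩
    funext i
    rw [Fin.fin_one_eq_zero i]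
    simp
  · rintro ⟨w, ⟨h0, h01, h1⟩, rfl⟩
    exact ⟨h0, w 1, h01, h1⟩

/-- `1/√f` is `ℚ`-semialgebraic on `σ`. [folklore] -/
theorem isSemialgebraicFunOn_inv_sqrt_cubic (q₂ q₃ : ℚ) :
    IsSemialgebraicFunOn ℚ (σ₁ q₂ q₃) (fun p => 1 / Real.sqrt (cubic q₂ q₃ (p 0))) := by
  have hσ := isSemialgebraic_σ₁ q₂ q₃
  set F : MvPolynomial (Fin 1) ℚ := 4 * MvPolynomial.X 0 ^ 3 - MvPolynomial.C q₂ * MvPolynomial.X 0 -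
    MvPolynomial.C q₃ with hF
  have hne : ∀ p ∈ σ₁ q₂ q₃, MvPolynomial.aeval p F ≠ 0 := by
    intro p hp
    rw [hF, mvaeval_cubic]
    exact hp.1.ne'
  have h1 := isSemialgebraicFunOn_aeval_div_aeval hσ (1 : MvPolynomial (Fin 1) ℚ) F hne
  have h2 : IsSemialgebraicFunOn ℚ (σ₁ q₂ q₃) (fun p => 1 / cubic q₂ q₃ (p 0)) := by
    refine h1.congr (fun p _ => ?_)
    simp only [hF, map_one, mvaeval_cubic]
  refine (IsSemialgebraicFunOn.sqrt_holds h2).congr (fun p _ => ?_)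
  simp only [one_div, Real.sqrt_inv]

/-- `1/√(−f)` is `ℚ`-semialgebraic on `σ'`. [folklore] -/
theorem isSemialgebraicFunOn_inv_sqrt_neg_cubic (q₂ q₃ : ℚ) :
    IsSemialgebraicFunOn ℚ (σ₂ q₂ q₃) (fun p => 1 / Real.sqrt (-cubic q₂ q₃ (p 0))) := by
  have hσ := isSemialgebraic_σ₂ q₂ q₃
  set F : MvPolynomial (Fin 1) ℚ := -(4 * MvPolynomial.X 0 ^ 3 - MvPolynomial.C q₂ * MvPolynomial.X 0 -
    MvPolynomial.C q₃) with hF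
  have hne : ∀ p ∈ σ₂ q₂ q₃, MvPolynomial.aeval p F ≠ 0 := by
    intro p hp
    rw [hF, map_neg, mvaeval_cubic, neg_ne_zero]
    exact hp.1.ne
  have h1 := isSemialgebraicFunOn_aeval_div_aeval hσ (1 : MvPolynomial (Fin 1) ℚ) F hne
  have h2 : IsSemialgebraicFunOn ℚ (σ₂ q₂ q₃) (fun p => 1 / (-cubic q₂ q₃ (p 0))) := by
    refine h1.congr (fun p _ => ?_)
    simp only [hF, map_one, map_neg, mvaeval_cubic]
  refine (IsSemialgebraicFunOn.sqrt_holds h2).congr (fun p _ => ?_)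
  simp only [one_div, Real.sqrt_inv]

/-- Multiplying a `ℚ`-semialgebraic function on a subset of `ℝ¹` by the coordinate keeps it
`ℚ`-semialgebraic. [folklore] -/
theorem isSemialgebraicFunOn_coord_mul {D : Set (Fin 1 → ℝ)} {φ : (Fin 1 → ℝ) → ℝ}
    (hφ : IsSemialgebraicFunOn ℚ D φ) :
    IsSemialgebraicFunOn ℚ D (fun p => p 0 * φ p) := by
  have hD : IsSemialgebraic ℚ D := IsSemialgebraicFunOn.isSemialgebraic_holds hφ
  have hX : IsSemialgebraicFunOn ℚ D (fun p => p 0) :=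
    (isSemialgebraicFunOn_aeval hD (MvPolynomial.X 0)).congr fun p _ => by simp
  exact (IsSemialgebraicFunOn.mul_holds hX hφ).congr fun p _ => by simp

/-- A representation with prescribed domain and integrand exists as soon as the three side
conditions hold (packaging). [folklore] -/
theorem exists_rep {D : Set (Fin 1 → ℝ)} {φ : (Fin 1 → ℝ) → ℝ} (hD : IsSemialgebraic ℚ D)
    (hφ : IsSemialgebraicFunOn ℚ D φ) (hint : IntegrableOn φ D) :
    ∃ b : KZ.IntegralRep 1, b.domain = D ∧ b.integrand = φ :=
  ⟨⟨D, φ, hD, hφ, hint⟩, rfl, rfl⟩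

/-- A set integral which is non-zero is the integral of an integrable function (Bochner's junk value
is `0`). [folklore] -/
theorem integrableOn_of_integral_ne_zero {D : Set (Fin 1 → ℝ)} {φ : (Fin 1 → ℝ) → ℝ}
    (h : (∫ p in D, φ p) ≠ 0) : IntegrableOn φ D := by
  by_contra hn
  exact h (integral_undef hn)

/-- The rigidity hypothesis makes the four basic integrals non-zero, hence their integrands
integrable (slots `b, c, d, e = 1`). [folklore] -/
theorem basis_integrable {q₂ q₃ : ℚ} (h : Rigidity q₂ q₃) :
    IntegrableOn (fun p : Fin 1 → ℝ => 1 / Real.sqrt (cubic q₂ q₃ (p 0))) (σ₁ q₂ q₃) ∧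
    IntegrableOn (fun p : Fin 1 → ℝ => p 0 / Real.sqrt (cubic q₂ q₃ (p 0))) (σ₁ q₂ q₃) ∧
    IntegrableOn (fun p : Fin 1 → ℝ => 1 / Real.sqrt (-cubic q₂ q₃ (p 0))) (σ₂ q₂ q₃) ∧
    IntegrableOn (fun p : Fin 1 → ℝ => p 0 / Real.sqrt (-cubic q₂ q₃ (p 0))) (σ₂ q₂ q₃) := by
  refine ⟨integrableOn_of_integral_ne_zero fun h0 => ?_, integrableOn_of_integral_ne_zero fun h0 => ?_,
    integrableOn_of_integral_ne_zero fun h0 => ?_, integrableOn_of_integral_ne_zero fun h0 => ?_⟩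
  · have := h 0 1 0 0 0 isAlgebraic_zero isAlgebraic_one isAlgebraic_zero isAlgebraic_zero
      isAlgebraic_zero (by rw [show J₀ q₂ q₃ = 0 from h0]; ring)
    exact one_ne_zero this.2.1
  · have := h 0 0 1 0 0 isAlgebraic_zero isAlgebraic_zero isAlgebraic_one isAlgebraic_zero
      isAlgebraic_zero (by rw [show J₁ q₂ q₃ = 0 from h0]; ring)
    exact one_ne_zero this.2.2.1
  · have := h 0 0 0 1 0 isAlgebraic_zero isAlgebraic_zero isAlgebraic_zero isAlgebraic_one
      isAlgebraic_zero (by rw [show K₀ q₂ q₃ = 0 from h0]; ring)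
    exact one_ne_zero this.2.2.2.1
  · have := h 0 0 0 0 1 isAlgebraic_zero isAlgebraic_zero isAlgebraic_zero isAlgebraic_zero
      isAlgebraic_one (by rw [show K₁ q₂ q₃ = 0 from h0]; ring)
    exact one_ne_zero this.2.2.2.2

/-- **The four basis representations exist**: `b₀ = [σ, 1/√f]`, `b₁ = [σ, x/√f]`,
`b₂ = [σ', 1/√(−f)]`, `b₃ = [σ', x/√(−f)]`, with integrands literally those of `J₀, J₁, K₀, K₁`.
[folklore] -/
theorem exists_basis {q₂ q₃ : ℚ} (h : Rigidity q₂ q₃) :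
    ∃ b₀ b₁ b₂ b₃ : KZ.IntegralRep 1,
      (b₀.domain = σ₁ q₂ q₃ ∧ b₀.integrand = fun p => 1 / Real.sqrt (cubic q₂ q₃ (p 0))) ∧
      (b₁.domain = σ₁ q₂ q₃ ∧ b₁.integrand = fun p => p 0 / Real.sqrt (cubic q₂ q₃ (p 0))) ∧
      (b₂.domain = σ₂ q₂ q₃ ∧ b₂.integrand = fun p => 1 / Real.sqrt (-cubic q₂ q₃ (p 0))) ∧
      (b₃.domain = σ₂ q₂ q₃ ∧ b₃.integrand = fun p => p 0 / Real.sqrt (-cubic q₂ q₃ (p 0))) := by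
  obtain ⟨i₀, i₁, i₂, i₃⟩ := basis_integrable h
  have s₀ := isSemialgebraicFunOn_inv_sqrt_cubic q₂ q₃
  have s₂ := isSemialgebraicFunOn_inv_sqrt_neg_cubic q₂ q₃
  have s₁ : IsSemialgebraicFunOn ℚ (σ₁ q₂ q₃) (fun p => p 0 / Real.sqrt (cubic q₂ q₃ (p 0))) :=
    (isSemialgebraicFunOn_coord_mul s₀).congr fun p _ => (div_eq_mul_one_div _ _).symm
  have s₃ : IsSemialgebraicFunOn ℚ (σ₂ q₂ q₃) (fun p => p 0 / Real.sqrt (-cubic q₂ q₃ (p 0))) :=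
    (isSemialgebraicFunOn_coord_mul s₂).congr fun p _ => (div_eq_mul_one_div _ _).symm
  obtain ⟨b₀, hb₀⟩ := exists_rep (isSemialgebraic_σ₁ q₂ q₃) s₀ i₀
  obtain ⟨b₁, hb₁⟩ := exists_rep (isSemialgebraic_σ₁ q₂ q₃) s₁ i₁
  obtain ⟨b₂, hb₂⟩ := exists_rep (isSemialgebraic_σ₂ q₂ q₃) s₂ i₂
  obtain ⟨b₃, hb₃⟩ := exists_rep (isSemialgebraic_σ₂ q₂ q₃) s₃ i₃
  exact ⟨b₀, b₁, b₂, b₃, hb₀, hb₁, hb₂, hb₃⟩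

/-! ## Glue: integer normal forms -/

/-- Integer division is a derived rule of the calculus: the formal period group
`FormalRep ⧸ relations` is uniquely divisible (`ReducedPeriodRingNegative.nsmul_bijective`).
[folklore] -/
theorem integerDivision (c : KZ.FormalRep) {N : ℕ} (hN : 0 < N) (h : N • c ∈ KZ.relations) :
    c ∈ KZ.relations := by
  rw [← KZ.toFormalPeriod_eq_zero_iff] at h ⊢
  rw [map_nsmul] at h
  have hinj :=
    (Summit.KontsevichZagierPeriods.KontsevichZagierPeriods.ReducedPeriodRingNegative.nsmul_bijective
      hN).1
  exact hinj (show N • KZ.toFormalPeriod c = N • (0 : KZ.FormalPeriodRing) by rw [smul_zero]; exact h)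

/-- The integer normal form predicate on four basis elements. (Local to the proof; a `Prop`-valued
abbreviation spelled out at each use.) Closure under addition. [folklore] -/
theorem nf_add {B₀ B₁ B₂ B₃ x y : KZ.FormalRep}
    (hx : ∃ (N : ℕ) (a₀ a₁ a₂ a₃ : ℤ), 0 < N ∧
      N • x - (a₀ • B₀ + a₁ • B₁ + a₂ • B₂ + a₃ • B₃) ∈ KZ.relations)
    (hy : ∃ (N : ℕ) (a₀ a₁ a₂ a₃ : ℤ), 0 < N ∧
      N • y - (a₀ • B₀ + a₁ • B₁ + a₂ • B₂ + a₃ • B₃) ∈ KZ.relations) :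
    ∃ (N : ℕ) (a₀ a₁ a₂ a₃ : ℤ), 0 < N ∧
      N • (x + y) - (a₀ • B₀ + a₁ • B₁ + a₂ • B₂ + a₃ • B₃) ∈ KZ.relations := by
  obtain ⟨N, a₀, a₁, a₂, a₃, hN, hx⟩ := hx
  obtain ⟨M, c₀, c₁, c₂, c₃, hM, hy⟩ := hy
  refine ⟨N * M, M * a₀ + N * c₀, M * a₁ + N * c₁, M * a₂ + N * c₂, M * a₃ + N * c₃,
    Nat.mul_pos hN hM, ?_⟩
  have key : (N * M) • (x + y) - ((M * a₀ + N * c₀) • B₀ + (M * a₁ + N * c₁) • B₁ +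
      (M * a₂ + N * c₂) • B₂ + (M * a₃ + N * c₃) • B₃)
      = (M : ℤ) • (N • x - (a₀ • B₀ + a₁ • B₁ + a₂ • B₂ + a₃ • B₃))
        + (N : ℤ) • (M • y - (c₀ • B₀ + c₁ • B₁ + c₂ • B₂ + c₃ • B₃)) := by
    module
  rw [key]
  exact add_mem (AddSubgroup.zsmul_mem _ hx _) (AddSubgroup.zsmul_mem _ hy _)

/-- Closure under negation. [folklore] -/
theorem nf_neg {B₀ B₁ B₂ B₃ x : KZ.FormalRep}
    (hx : ∃ (N : ℕ) (a₀ a₁ a₂ a₃ : ℤ), 0 < N ∧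
      N • x - (a₀ • B₀ + a₁ • B₁ + a₂ • B₂ + a₃ • B₃) ∈ KZ.relations) :
    ∃ (N : ℕ) (a₀ a₁ a₂ a₃ : ℤ), 0 < N ∧
      N • (-x) - (a₀ • B₀ + a₁ • B₁ + a₂ • B₂ + a₃ • B₃) ∈ KZ.relations := by
  obtain ⟨N, a₀, a₁, a₂, a₃, hN, hx⟩ := hx
  refine ⟨N, -a₀, -a₁, -a₂, -a₃, hN, ?_⟩
  have key : N • (-x) - ((-a₀) • B₀ + (-a₁) • B₁ + (-a₂) • B₂ + (-a₃) • B₃)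
      = -(N • x - (a₀ • B₀ + a₁ • B₁ + a₂ • B₂ + a₃ • B₃)) := by
    module
  rw [key]
  exact neg_mem hx

/-- **Kernel step**: an element in integer normal form whose value vanishes is a relation, provided
the four basis values are `ℚ`-linearly independent (soundness of the moves, then integer division).
[folklore] -/
theorem mem_relations_of_nf {b₀ b₁ b₂ b₃ : KZ.IntegralRep 1}
    (hind : ∀ a₀ a₁ a₂ a₃ : ℚ, (a₀ : ℝ) * b₀.value + a₁ * b₁.value + a₂ * b₂.value + a₃ * b₃.value = 0 →
      a₀ = 0 ∧ a₁ = 0 ∧ a₂ = 0 ∧ a₃ = 0)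
    {c : KZ.FormalRep} (hc0 : KZ.eval c = 0)
    (hc : ∃ (N : ℕ) (a₀ a₁ a₂ a₃ : ℤ), 0 < N ∧
      N • c - (a₀ • KZ.of b₀ + a₁ • KZ.of b₁ + a₂ • KZ.of b₂ + a₃ • KZ.of b₃) ∈ KZ.relations) :
    c ∈ KZ.relations := by
  obtain ⟨N, a₀, a₁, a₂, a₃, hN, hnf⟩ := hc
  have hsound : KZ.eval (N • c - (a₀ • KZ.of b₀ + a₁ • KZ.of b₁ + a₂ • KZ.of b₂ + a₃ • KZ.of b₃)) = 0 :=
    (AddMonoidHom.mem_ker).1 (KZ.relations_le_ker_eval_holds hnf)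
  have hlin : (a₀ : ℝ) * b₀.value + a₁ * b₁.value + a₂ * b₂.value + a₃ * b₃.value = 0 := by
    simp only [map_sub, map_nsmul, map_add, map_zsmul, hc0, smul_zero, zero_sub, neg_eq_zero,
      zsmul_eq_mul, KZ.eval_of] at hsound
    linarith
  obtain ⟨r0, r1, r2, r3⟩ := hind a₀ a₁ a₂ a₃ (by push_cast; exact hlin)
  have e0 : a₀ = 0 := by exact_mod_cast r0
  have e1 : a₁ = 0 := by exact_mod_cast r1
  have e2 : a₂ = 0 := by exact_mod_cast r2
  have e3 : a₃ = 0 := by exact_mod_cast r3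
  subst e0 e1 e2 e3
  simp only [zero_smul, add_zero, sub_zero] at hnf
  exact integerDivision c hN hnf

/-! ## Composition -/

/-- **The line closes the crux**: roots + exact form + two-torsion + reduction ⇒
`RealEllipticSectorKernel`. Every generator is put in integer normal form on the four basis
representations (`σ`: reduction with `g = f` on `(e₃,e₂)`; `σ'`: reduction with `g = −f` on
`(e₂,e₁)`; `σ''`: the two-torsion move onto `b₀`), normal forms are closed under the group
operations, and a normal form of value `0` is a relation by ℚ-rigidity of `(J₀,J₁,K₀,K₁)` and integer
division. [folklore] -/
theorem RealEllipticSectorKernel_of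
    (hroots : ∀ (q₂ q₃ : ℚ), 0 < discr q₂ q₃ →
      ∃ e₁ e₂ e₃ : ℝ, e₃ < e₂ ∧ e₂ < e₁ ∧ IsAlgebraic ℚ e₁ ∧ IsAlgebraic ℚ e₂ ∧ IsAlgebraic ℚ e₃ ∧
        (∀ x, cubic q₂ q₃ x = 4 * (x - e₁) * (x - e₂) * (x - e₃)) ∧
        σ₁ q₂ q₃ = {p | e₃ < p 0 ∧ p 0 < e₂} ∧
        σ₂ q₂ q₃ = {p | e₂ < p 0 ∧ p 0 < e₁} ∧
        σ₃ q₂ q₃ = {p | e₁ < p 0})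
    (hexact : ∀ (g Q : ℚ[X]) (u v : ℝ), u < v → aeval u g = 0 → aeval v g = 0 →
      (∀ x ∈ Ioo u v, 0 < aeval x g) →
      ∀ (r : KZ.IntegralRep 1), r.domain = {p | u < p 0 ∧ p 0 < v} →
        EqOn r.integrand (fun p => (aeval (p 0) (derivative Q) * aeval (p 0) g
          + aeval (p 0) Q * aeval (p 0) (derivative g) / 2) / Real.sqrt (aeval (p 0) g)) r.domain →
        KZ.of r ∈ KZ.relations)
    (htors : ∀ (q₂ q₃ : ℚ) (e₁ e₂ e₃ : ℝ), e₃ < e₂ → e₂ < e₁ →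
      IsAlgebraic ℚ e₁ → IsAlgebraic ℚ e₂ → IsAlgebraic ℚ e₃ →
      (∀ x, cubic q₂ q₃ x = 4 * (x - e₁) * (x - e₂) * (x - e₃)) →
      ∀ (r'' r : KZ.IntegralRep 1), r''.domain = {p | e₁ < p 0} →
        EqOn r''.integrand (fun p => 1 / Real.sqrt (cubic q₂ q₃ (p 0))) r''.domain →
        r.domain = {p | e₃ < p 0 ∧ p 0 < e₂} →
        EqOn r.integrand (fun p => 1 / Real.sqrt (cubic q₂ q₃ (p 0))) r.domain →
        KZ.of r'' - KZ.of r ∈ KZ.relations)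
    (hred : ∀ (g : ℚ[X]), g.natDegree = 3 → ∀ (u v : ℝ),
      (∀ (Q : ℚ[X]) (s : KZ.IntegralRep 1), s.domain = {p | u < p 0 ∧ p 0 < v} →
        EqOn s.integrand (fun p => (aeval (p 0) (derivative Q) * aeval (p 0) g
          + aeval (p 0) Q * aeval (p 0) (derivative g) / 2) / Real.sqrt (aeval (p 0) g)) s.domain →
        KZ.of s ∈ KZ.relations) →
      ∀ (b₀ b₁ r : KZ.IntegralRep 1) (m : ℕ),
        b₀.domain = {p | u < p 0 ∧ p 0 < v} →
        EqOn b₀.integrand (fun p => 1 / Real.sqrt (aeval (p 0) g)) b₀.domain →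
        b₁.domain = {p | u < p 0 ∧ p 0 < v} →
        EqOn b₁.integrand (fun p => p 0 / Real.sqrt (aeval (p 0) g)) b₁.domain →
        r.domain = {p | u < p 0 ∧ p 0 < v} →
        EqOn r.integrand (fun p => p 0 ^ m / Real.sqrt (aeval (p 0) g)) r.domain →
        ∃ (N : ℕ) (a b : ℤ), 0 < N ∧ N • KZ.of r - (a • KZ.of b₀ + b • KZ.of b₁) ∈ KZ.relations) :
    RealEllipticSectorKernel := by
  refine crux_iff.mpr fun q₂ q₃ hΔ hrig => ?_
  -- roots and intervals
  obtain ⟨e₁, e₂, e₃, h32, h21, ha₁, ha₂, ha₃, hf, hσ₁, hσ₂, hσ₃⟩ := hroots q₂ q₃ hΔ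
  -- the two polynomials
  set g₁ : ℚ[X] := 4 * X ^ 3 - C q₂ * X - C q₃ with hg₁
  set g₂ : ℚ[X] := -(4 * X ^ 3 - C q₂ * X - C q₃) with hg₂
  have hag₁ : ∀ x : ℝ, aeval x g₁ = cubic q₂ q₃ x := aeval_cubicPoly q₂ q₃
  have hag₂ : ∀ x : ℝ, aeval x g₂ = - cubic q₂ q₃ x := aeval_neg_cubicPoly q₂ q₃
  have hdeg₁ : g₁.natDegree = 3 := natDegree_cubicPoly q₂ q₃
  have hdeg₂ : g₂.natDegree = 3 := natDegree_neg_cubicPoly q₂ q₃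
  have hroot : ∀ e, (e = e₁ ∨ e = e₂ ∨ e = e₃) → cubic q₂ q₃ e = 0 := by
    rintro e (rfl | rfl | rfl) <;> rw [hf] <;> ring
  have hpos₁ : ∀ x ∈ Ioo e₃ e₂, 0 < aeval x g₁ := by
    intro x hx
    rw [hag₁, hf]
    have h1 : 0 < x - e₃ := by linarith [hx.1]
    have h2 : 0 < e₂ - x := by linarith [hx.2]
    have h3 : 0 < e₁ - x := by linarith [hx.2]
    have : 0 < 4 * (e₁ - x) * (e₂ - x) * (x - e₃) := by positivity
    linarith
  have hpos₂ : ∀ x ∈ Ioo e₂ e₁, 0 < aeval x g₂ := by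
    intro x hx
    rw [hag₂, hf]
    have h1 : 0 < x - e₃ := by linarith [hx.1]
    have h2 : 0 < x - e₂ := by linarith [hx.1]
    have h3 : 0 < e₁ - x := by linarith [hx.2]
    have : 0 < 4 * (e₁ - x) * (x - e₂) * (x - e₃) := by positivity
    linarith
  -- the exact-form property on the two ovals
  have hEx₁ : ∀ (Q : ℚ[X]) (s : KZ.IntegralRep 1), s.domain = {p | e₃ < p 0 ∧ p 0 < e₂} →
      EqOn s.integrand (fun p => (aeval (p 0) (derivative Q) * aeval (p 0) g₁
        + aeval (p 0) Q * aeval (p 0) (derivative g₁) / 2) / Real.sqrt (aeval (p 0) g₁)) s.domain →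
      KZ.of s ∈ KZ.relations := fun Q s hs hsi =>
    hexact g₁ Q e₃ e₂ h32 (by rw [hag₁]; exact hroot _ (Or.inr (Or.inr rfl)))
      (by rw [hag₁]; exact hroot _ (Or.inr (Or.inl rfl))) hpos₁ s hs hsi
  have hEx₂ : ∀ (Q : ℚ[X]) (s : KZ.IntegralRep 1), s.domain = {p | e₂ < p 0 ∧ p 0 < e₁} →
      EqOn s.integrand (fun p => (aeval (p 0) (derivative Q) * aeval (p 0) g₂
        + aeval (p 0) Q * aeval (p 0) (derivative g₂) / 2) / Real.sqrt (aeval (p 0) g₂)) s.domain →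
      KZ.of s ∈ KZ.relations := fun Q s hs hsi =>
    hexact g₂ Q e₂ e₁ h21 (by rw [hag₂, hroot _ (Or.inr (Or.inl rfl)), neg_zero])
      (by rw [hag₂, hroot _ (Or.inl rfl), neg_zero]) hpos₂ s hs hsi
  -- the four basis representations
  obtain ⟨b₀, b₁, b₂, b₃, ⟨hb₀d, hb₀i⟩, ⟨hb₁d, hb₁i⟩, ⟨hb₂d, hb₂i⟩, ⟨hb₃d, hb₃i⟩⟩ := exists_basis hrig
  -- their values
  have hv₀ : b₀.value = J₀ q₂ q₃ := by unfold KZ.IntegralRep.value J₀; rw [hb₀d, hb₀i]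
  have hv₁ : b₁.value = J₁ q₂ q₃ := by unfold KZ.IntegralRep.value J₁; rw [hb₁d, hb₁i]
  have hv₂ : b₂.value = K₀ q₂ q₃ := by unfold KZ.IntegralRep.value K₀; rw [hb₂d, hb₂i]
  have hv₃ : b₃.value = K₁ q₂ q₃ := by unfold KZ.IntegralRep.value K₁; rw [hb₃d, hb₃i]
  have hind : ∀ a₀ a₁ a₂ a₃ : ℚ, (a₀ : ℝ) * b₀.value + a₁ * b₁.value + a₂ * b₂.value + a₃ * b₃.value = 0 →
      a₀ = 0 ∧ a₁ = 0 ∧ a₂ = 0 ∧ a₃ = 0 := by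
    intro a₀ a₁ a₂ a₃ h
    rw [hv₀, hv₁, hv₂, hv₃] at h
    exact qRigidity_of_rigidity hrig a₀ a₁ a₂ a₃ h
  -- integer normal forms of the generators
  have hgen : ∀ s ∈ Gens q₂ q₃, ∃ (N : ℕ) (a₀ a₁ a₂ a₃ : ℤ), 0 < N ∧
      N • s - (a₀ • KZ.of b₀ + a₁ • KZ.of b₁ + a₂ • KZ.of b₂ + a₃ • KZ.of b₃) ∈ KZ.relations := by
    rintro s ((⟨r, m, hrd, hri, rfl⟩ | ⟨r, m, hrd, hri, rfl⟩) | ⟨r, hrd, hri, rfl⟩)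
    · -- first family: reduction on `σ = (e₃,e₂)` with `g = f`
      obtain ⟨N, a, b, hN, h⟩ := hred g₁ hdeg₁ e₃ e₂ hEx₁ b₀ b₁ r m
        (by rw [hb₀d, hσ₁]) (by rw [hb₀i]; intro p _; simp only [hag₁])
        (by rw [hb₁d, hσ₁]) (by rw [hb₁i]; intro p _; simp only [hag₁])
        (by rw [hrd, hσ₁]) (by rw [hrd]; intro p hp; rw [hri hp]; simp only [hag₁])
      refine ⟨N, a, b, 0, 0, hN, ?_⟩
      simpa using h
    · -- second family: reduction on `σ' = (e₂,e₁)` with `g = -f`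
      obtain ⟨N, a, b, hN, h⟩ := hred g₂ hdeg₂ e₂ e₁ hEx₂ b₂ b₃ r m
        (by rw [hb₂d, hσ₂]) (by rw [hb₂i]; intro p _; simp only [hag₂])
        (by rw [hb₃d, hσ₂]) (by rw [hb₃i]; intro p _; simp only [hag₂])
        (by rw [hrd, hσ₂]) (by rw [hrd]; intro p hp; rw [hri hp]; simp only [hag₂])
      refine ⟨N, 0, 0, a, b, hN, ?_⟩
      have e : N • KZ.of r - ((0 : ℤ) • KZ.of b₀ + (0 : ℤ) • KZ.of b₁ + a • KZ.of b₂ + b • KZ.of b₃)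
          = N • KZ.of r - (a • KZ.of b₂ + b • KZ.of b₃) := by
        simp only [zero_smul, zero_add]
      rw [e]; exact h
    · -- third family: the two-torsion move onto `b₀`
      have h := htors q₂ q₃ e₁ e₂ e₃ h32 h21 ha₁ ha₂ ha₃ hf r b₀ (by rw [hrd, hσ₃])
        (by rw [hrd]; exact hri) (by rw [hb₀d, hσ₁]) (by rw [hb₀i]; intro p _; rfl)
      refine ⟨1, 1, 0, 0, 0, one_pos, ?_⟩
      simpa using h
  -- closure induction
  intro c hc hc0
  have hnf : ∃ (N : ℕ) (a₀ a₁ a₂ a₃ : ℤ), 0 < N ∧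
      N • c - (a₀ • KZ.of b₀ + a₁ • KZ.of b₁ + a₂ • KZ.of b₂ + a₃ • KZ.of b₃) ∈ KZ.relations := by
    refine AddSubgroup.closure_induction (p := fun c _ => ∃ (N : ℕ) (a₀ a₁ a₂ a₃ : ℤ), 0 < N ∧
        N • c - (a₀ • KZ.of b₀ + a₁ • KZ.of b₁ + a₂ • KZ.of b₂ + a₃ • KZ.of b₃) ∈ KZ.relations)
      (fun s hs => hgen s hs) ?_ (fun x y _ _ hx hy => nf_add hx hy) (fun x _ hx => nf_neg hx) hc
    exact ⟨1, 0, 0, 0, 0, one_pos, by simp [KZ.relations.zero_mem]⟩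
  exact mem_relations_of_nf hind hc0 hnf

/-- **The line closes**: the crux `RealEllipticSectorKernel`, from the four stubs — `stub_roots`
(Part D, = landed `…StubRoots.lean`), `stub_exactForm` (LANDED, p76437, imported by FQN),
`stub_twoTorsion` (Part B), `stub_reduction` (Part C) — through the skeleton's own sorry-free
composition (Part E). Certificate only: the crux is the lead's to land. -/
theorem realEllipticSectorKernel_lineClosed : RealEllipticSectorKernel :=
  RealEllipticSectorKernel_of stub_roots
    Summit.KontsevichZagierPeriods.HermiteRigidity.RealEllipticSectorKernel.stub_exactForm
    stub_twoTorsion stub_reduction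


/-! # Part F — bonus: the route support `TwoTorsionTransfer` (stmt-KontsevichZagierPeriods-3413) follows -/

/-- **The support item `TwoTorsionTransfer` (3413), from `stub_roots` + `stub_twoTorsion`**: for
`q₂ q₃ ∈ ℚ` with `Δ > 0`, `[σ'', 1/√f] ~ [σ, 1/√f]` for arbitrary presentations (the typed root-free
`σ'' , σ` are the intervals `(e₁,∞)`, `(e₃,e₂)` by `stub_roots`; then ONE rule-2 move,
`stub_twoTorsion`). Certificate only — a prover lands it for item 3413.
[cite: WhittakerWatson1927, §20.33] -/
theorem twoTorsionTransfer_candidate :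
    Summit.KontsevichZagierPeriods.KontsevichZagierPeriods.Theses.HermiteRigidity.TwoTorsionTransfer := by
  intro q₂ q₃ hΔ f σ σ'' r r' hr hri hr' hri'
  obtain ⟨e₁, e₂, e₃, h32, h21, ha₁, ha₂, ha₃, hf, hσ₁, -, hσ₃⟩ := stub_roots q₂ q₃ hΔ
  have hr3 : r.domain = {p : Fin 1 → ℝ | e₁ < p 0} := by
    rw [← hσ₃]; exact hr
  have hr1 : r'.domain = {p : Fin 1 → ℝ | e₃ < p 0 ∧ p 0 < e₂} := by
    rw [← hσ₁]; exact hr'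
  have hi3 : EqOn r.integrand (fun p => 1 / Real.sqrt (cubic q₂ q₃ (p 0))) r.domain := by
    rw [hr]; exact hri
  have hi1 : EqOn r'.integrand (fun p => 1 / Real.sqrt (cubic q₂ q₃ (p 0))) r'.domain := by
    rw [hr']; exact hri'
  exact stub_twoTorsion q₂ q₃ e₁ e₂ e₃ h32 h21 ha₁ ha₂ ha₃ hf r r' hr3 hi3 hr1 hi1

end Summit.KontsevichZagierPeriods.HermiteRigidity.RealEllipticSectorKernel.DrefuteG3

end
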